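import Literature.Computability.MetaComplexity.ConstructiveSeparationsProofs
import Literature.Computability.MetaComplexity.ConstructiveSeparationsNP
import Literature.Computability.Complexity.BPPErrorReductionStrong
import Literature.Computability.Complexity.CountingHierarchyProofs
import Literature.Computability.Complexity.UniformProbBlocks
import Literature.Computability.Complexity.CodeFPBudgets
import HarnessLib

/-!
# Refuters for `NP` against `BPP`: discharge of `constructiveSeparation_of_not_subset_BPP_NP` (Chen–Jin–Santhanam–Williams, Thm. 1.2)

Topic `Literature/Computability/MetaComplexity`. Proof file (in three parts, below) for the named fact
`constructiveSeparation_of_not_subset_BPP_NP` of `ConstructiveSeparations.lean`: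
**Thm. 1.2 of [ChenEtAl2022] for `(𝒞, 𝒟) = (BPP, NP)`** — if `NP ⊄ BPP` then for every length-paddable
`NP`-complete `L` and every `L'' ∈ BPP` there is a probabilistic polynomial-time refuter which, on `1ᵐ`,
prints an `m`-bit string of `L ∆ L''` with probability `≥ 2/3`, for infinitely many `m` — proved as
`constructiveSeparation_of_not_subset_BPP_NP_holds`.

## The printed proof, its gap, and the argument formalised here

[ChenEtAl2022, §5.2] proves the `Σₖᵖ` instances of Thm. 1.2 (Thm. 5, "Adaptation of
[GutfreundST07]") for `𝒞 = P` by a two-level search-to-decision construction producing a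
constant-size LIST one of whose strings is a counterexample (this tree: `GSTRefuter`,
`pConstructiveSeparation_of_not_NP_subset_P_holds`), converted into a refuter by Lemma 6 (some list
position is hit for infinitely many `n`; print that position on its own input length), and delegates
`𝒞 ∈ {BPP, ZPP}` to "the same proof … and apply the amplification argument described at the end of
the proof of Theorem 4": replace the refuted algorithm by `A'(·, r)` for a random seed `r` of its
amplification. For `𝒟 = NP` the level-2 `NP`-questions mention the refuted algorithm, so `r` has to be
written into the query instances (`BPPNPRefuter.Data.H₂`, `….inst`, Part I); the refuted language `L''` may then
answer the instances of different seeds differently, the list is not pseudo-deterministic, and Lemma 6 —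
stated for pseudo-deterministic list-refuters — does not apply as printed (a fixed list position is
then only hit with probability `≥ 1/c`, not `2/3`; cf. Gutfreund–Shaltiel–Ta-Shma 2007, Remark 4.2, and
Gutfreund 2006, §3.2 "the 1/3 barrier"). The formalisation closes this gap inside the paper's own
framework by two devices.

1. **Every search depth gets its own input length.** The level-2 query of depth `k` at stage `n` is
   asked — and printed — at length `P(n) + k` (`BPPNPRefuter.Data.P`, gaps `> n`, so the refuter
   recovers `(n, k)` from its input length as in the proof of Lemma 6). No pigeonhole over list
   positions and no detection of "the inconsistent position" is needed.
2. **Contradiction over a finite family of candidates.** Eight probabilistic polynomial-time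
   candidates are fielded (`….outM b`, `b ∈ {0,1}`: at length `P(n) + k` walk `k` steps of the
   level-2 search, asking each query through ONE fresh seed, then print a fresh-seed instance of the
   current query that the amplified decider answers `b`; `….outY`: print the walk's end point;
   `….outJ j`, `j < 5`: print the `j`-th level-1 probe instance at the end point). If none of them is
   a refuter, then at every large bad stage `n`, by induction on the depth `k`: were `L''` wrong on a
   `≥ n⁻³` fraction of the seeds' instances of the canonical depth-`k` query, the candidate printing
   wrongly-answered instances would succeed at length `P(n) + k` with probability `→ 1`
   (`BPPNPRefuter.Data.harvest`) — so it is right on all but `n⁻³` of them, the walk's `k`-th step is the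
   canonical one with that probability, and (union bound over `k ≤ n`, over the goodness of the
   evaluation block and of the seeds, `BPPNPRefuter.Data.uniformProb_not_coinGood_le`) the walk ends
   at the canonical detectably-bad string `y*` with probability `≥ 1 - o(1)`; the remaining
   candidates are then pseudo-deterministic, so `L''` is right on `y*` and on the five level-1 probe
   instances at `y*` (`BPPNPRefuter.Data.endgameY`, `….endgameJ`), which contradicts the soundness of the
   witness search (`BPPNPRefuter.Data.false_of_correct`, i.e. `GSTRefuter.searchZ_sound`). Hence
   one of the eight IS a refuter. (The constant `2/3` plays no role: any constant `< 1` works.)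

All machines are `FP` functions obtained from the `CodeFP` algebra (`….codeFP_outM` etc.), wrapped as
Gill machines on the unary input with an exactly polynomial coin budget (`BPPNPRefuter.unaryAlg`);
probabilities are counting probabilities (`uniformProb`), estimated by cylinder/block lemmas
(`uniformProb_take_of_le`, `uniformProb_block_le`, `cnt_consecutiveBlocks`) and Bernoulli's inequality.

## References

* [ChenEtAl2022] L. Chen, C. Jin, R. Santhanam, R. Williams, *Constructive separations and their
  consequences*, FOCS 2021 / TheoretiCS 3 (2024), arXiv:2203.14379v5: Def. 1.1, Thm. 1.2, §5.1
  (Def. 4, Lemma 6, Thm. 4 and its amplification step), §5.2 (Thm. 5, Cor. 4).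
* [GutfreundShaltielTashma2007] D. Gutfreund, R. Shaltiel, A. Ta-Shma, *If NP languages are hard on
  the worst-case, then it is easy to find their hard instances*, comput. complex. 16 (2007), Lemma 4.1,
  Remark 4.2, §4.1.
* D. Gutfreund, *Worst-case vs. algorithmic average-case complexity in the polynomial-time
  hierarchy*, RANDOM 2006, LNCS 4110, §3.2.
* [AroraBarakCC2009] S. Arora, B. Barak, *Computational Complexity*, CUP 2009, §7.1, §7.4.1, §A.2.
-/

/-!
## Part I: the two-level search with coins in the instance

Part I of the proof of `constructiveSeparation_of_not_subset_BPP_NP` (`ConstructiveSeparations.lean`; [ChenEtAl2022]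
L. Chen, C. Jin, R. Santhanam, R. Williams, *Constructive separations and their consequences*,
FOCS 2021 / TheoretiCS 3 (2024) = arXiv:2203.14379v5, Thm. 1.2 for `(𝒞, 𝒟) = (BPP, NP)`; §5.2,
Thm. 5 "Adaptation of [GutfreundST07]" with the amplification step of the proof of Thm. 4, §5.1).

The printed proof of the randomized case is the sentence "For `𝒞 ∈ {BPP, ZPP}`, we use the same
proof as the `𝒞 = PTIME` case, and apply the amplification argument described at the end of the
proof of Theorem 4": amplify the refuted algorithm to `A'` with error `2^{-2n}`, fix a uniformly
random seed `r`, and run the deterministic two-level search-to-decision construction (this tree: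
`GSTRefuter`, `ConstructiveSeparationsProofs.lean`) against the deterministic predicate
`A'(·, r)`. For `𝒟 = NP` the level-2 questions "is there a detectably bad `y ∈ {0,1}ⁿ` extending
`z`?" mention the refuted algorithm, so they are `NP`-questions — Karp-reducible to the
`NP`-complete `L` — only with the seed `r` written INTO the instance. This file renders exactly
that: the level-1 witness search of `GSTRefuter` driven by an arbitrary answer function `a`
(`B₁`, `found`, `searchFails`, `probes₁`, `probeInst`), the detectably-bad predicate `bad₂ a`, the
coin-carrying level-2 language `H₂ = {⟨⟨1ⁿ, r⟩, z⟩ : ∃ y ∈ {0,1}ⁿ, z ⊑ y, bad₂ (A'(·, r)) y} ∈ NP`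
(`H₂_mem_NP`), its padded instances `inst n r z m` of any prescribed length `m`, the amplified
decider bit `amp x c = A'(x, c)` with the event `CoinGood lo hi c` ("`A'(·, c)` decides `L''` on all
inputs of lengths `lo … hi`", probability `≥ 1 - 2·2^{-lo}`, `uniformProb_not_coinGood_le`), and the
TRUTH side of the analysis: the canonical predicate `T n z = ∃ y ∈ {0,1}ⁿ, z ⊑ y, bad₂ (L'') y`, its
canonical search path `zst n k` and bad string `yst n` (`bad₂_yst`), and the level-1 endgame
`false_of_correct` (if `L''` is right on a detectably bad `y` and on the five level-1 probe
instances at `y`, contradiction — `GSTRefuter.searchZ_sound`).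

How the gap in the printed sketch is closed (the list-refuter lemma, Lemma 6, needs a
PSEUDO-DETERMINISTIC list, which the coin-carrying queries do not give) is the business of
Parts II (every search depth gets its own input length) and III (the argument by contradiction over a
finite family of candidate refuters); see the module docstring above.

## References

* [ChenEtAl2022] L. Chen, C. Jin, R. Santhanam, R. Williams, FOCS 2021 / arXiv:2203.14379v5,
  Def. 1.1, Thm. 1.2, §5.1 (Thm. 4, amplification step), §5.2 (Thm. 5).
* [GutfreundShaltielTashma2007] D. Gutfreund, R. Shaltiel, A. Ta-Shma, comput. complex. 16 (2007),
  Lemma 3.1 / 4.1 (the two-level search), §4.1 (Adleman's argument on the amplified algorithm).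
* [AroraBarakCC2009] S. Arora, B. Barak, *Computational Complexity*, CUP 2009, Thm. 7.10, §7.4.1.
-/

noncomputable section

namespace Literature.Computability.MetaComplexity

open _root_.Computability Complexity Filter Polynomial Brick CodeFP GSTRefuter

namespace BPPNPRefuter

/-! ### The data -/

/-- **The data of the construction**: the paddable `NP`-complete language `L` with its padding and
verifier (`Vb`, witness length `p`), the refuted language `L'' ∈ BPP`, and an amplified
`P`-witness `Lamp` of `L''` with coin polynomial `q` (`A'(x, c) = [⟨x, c↾q(|x|)⟩ ∈ Lamp]`).
[cite: ChenEtAl2022, §5.1 (proof of Thm. 4, case 𝒞 = BPP) and §5.2 (Thm. 5)] -/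
structure Data where
  /-- the paddable `NP`-complete language -/
  L : Language Bool
  /-- its length padding -/
  pad : List Bool × ℕ → List Bool
  /-- the verifier bit of `L` -/
  Vb : List Bool → Bool
  /-- the witness-length polynomial -/
  p : Polynomial ℕ
  /-- the refuted `BPP` language -/
  L'' : Language Bool
  /-- the amplified `P`-witness of `L''` -/
  Lamp : Language Bool
  /-- its coin polynomial -/
  q : Polynomial ℕ

namespace Data

variable (D : Data)

/-- The underlying `GSTRefuter.Setting` (its slot for the refuted algorithm is unused: the constant
`true`). [folklore] -/
def S : Setting := ⟨D.L, D.pad, fun _ => true, D.Vb, D.p⟩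

/-- The setting's language is `L`. [folklore] -/
@[simp] theorem S_L : D.S.L = D.L := rfl

/-- The setting's padding is `pad`. [folklore] -/
@[simp] theorem S_pad : D.S.pad = D.pad := rfl

/-- The setting's verifier is `Vb`. [folklore] -/
@[simp] theorem S_Vb : D.S.Vb = D.Vb := rfl

/-- The setting's witness polynomial is `p`. [folklore] -/
@[simp] theorem S_p : D.S.p = D.p := rfl

/-- **Correctness of the data**: padding and verifier as in `GSTRefuter.Setting.Spec`, and `Lamp`
has wrong-verdict probability `≤ 2^{-|x|²}` on every input `x` (strong error reduction,
`BPP_subset_bpErr_two_pow 2`). [cite: ChenEtAl2022, §5.1 (proof of Thm. 4: "success probability 1 - 2^{-2n}")] -/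
structure Spec : Prop where
  /-- padding and verifier -/
  spec : D.S.Spec
  /-- the amplified witness errs with probability `≤ 2^{-|x|²}` -/
  amp : ∀ x : List Bool,
    uniformProb (D.q.eval x.length) {y | ¬ (boolPair x y ∈ D.Lamp ↔ x ∈ D.L'')} ≤ 1 / 2 ^ (x.length ^ 2)

/-- **The data is polynomial time.** [cite: ChenEtAl2022, §5.2 (proof of Thm. 5)] -/
structure Codes : Prop where
  /-- the padding -/
  pad : CodeFP (pairE strE unE) strE D.pad
  /-- the verifier -/
  Vb : CodeFP strE bitE D.Vb
  /-- the amplified witness -/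
  Lamp : D.Lamp ∈ Classes.P

/-- The underlying setting is polynomial time. [folklore] -/
theorem Codes.S {D : Data} (h : D.Codes) : D.S.Codes :=
  ⟨h.pad, CodeFP.const strE true, h.Vb⟩

/-! ### The amplified decider bit and exact answers -/

/-- **The amplified decider** `A'(x, c) = [⟨x, c↾q(|x|)⟩ ∈ Lamp]` (only the first `q(|x|)` coins are
read, so that one long coin block serves all input lengths). [cite: ChenEtAl2022, §5.1 (proof of Thm. 4, the algorithm A'(·, r))] -/
def amp (x c : List Bool) : Bool :=
  D.Lamp.boolIndicator (boolPair x (c.take (D.q.eval x.length)))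

/-- The exact answers of the refuted language. [folklore] -/
def aT (x : List Bool) : Bool :=
  D.L''.boolIndicator x

/-- `aT x = true ↔ x ∈ L''`. [folklore] -/
theorem aT_eq_true_iff (x : List Bool) : D.aT x = true ↔ x ∈ D.L'' :=
  (Set.mem_iff_boolIndicator _ _).symm

/-- **Good coin blocks**: `A'(·, c)` decides `L''` on every input of length between `lo` and `hi`.
[cite: ChenEtAl2022, §5.1 (proof of Thm. 4: "with 1 - 2^{-n} probability, A'(·, r) decides the same language as A on input length n")] -/
def CoinGood (lo hi : ℕ) (c : List Bool) : Prop :=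
  ∀ x : List Bool, lo ≤ x.length → x.length ≤ hi → (D.amp x c = true ↔ x ∈ D.L'')

/-- On a good block the amplified bit is the exact answer. [folklore] -/
theorem amp_eq_aT {lo hi : ℕ} {c : List Bool} (hc : D.CoinGood lo hi c) {x : List Bool}
    (h1 : lo ≤ x.length) (h2 : x.length ≤ hi) : D.amp x c = D.aT x := by
  rw [Bool.eq_iff_iff, hc x h1 h2, aT_eq_true_iff]

/-- Goodness is monotone in the length window. [folklore] -/
theorem CoinGood.mono {D : Data} {lo hi lo' hi' : ℕ} {c : List Bool} (hc : D.CoinGood lo hi c) (h1 : lo ≤ lo')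
    (h2 : hi' ≤ hi) : D.CoinGood lo' hi' c :=
  fun x hx1 hx2 => hc x (h1.trans hx1) (hx2.trans h2)

/-- The amplified decider bit is polynomial time (for `Lamp ∈ P`). [cite: AroraBarak2009, §1.3] -/
theorem codeFP_amp (hC : D.Codes) : CodeFP (pairE strE strE) bitE fun t => D.amp t.1 t.2 := by
  have hind : CodeFP strE bitE (fun w => D.Lamp.boolIndicator w) :=
    of_fn _ (indicatorFn_mem_FP hC.Lamp) fun _ => rfl
  have hq : CodeFP (pairE strE strE) unE (fun t => D.q.eval t.1.length) :=
    (codeFP_unPoly D.q).comp (strLength.comp (fst _ _))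
  have ht : CodeFP (pairE strE strE) strE (fun t => t.2.take (D.q.eval t.1.length)) :=
    strTake.comp (hq.pair (snd _ _))
  have harg : CodeFP (pairE strE strE) strE (fun t => boolPair t.1 (t.2.take (D.q.eval t.1.length))) :=
    ((fst _ _).pair ht).recodeOut fun _ => rfl
  exact (hind.comp harg).congr fun _ => rfl

/-! ### Level 1 driven by an arbitrary answer function -/

section Level1

variable (R₁ : Red D.S.H₁ D.L)

/-- The level-1 oracle bit: the answer function on the padded query `g₁ y z`. [cite: ChenEtAl2022, §5.2 (proof of Thm. 5)] -/
def B₁ (a : List Bool → Bool) (y z : List Bool) : Bool :=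
  a (D.S.g₁ R₁ y z)

/-- The string found by the `a`-driven witness search on `y`. [cite: ChenEtAl2022, §5.2 (proof of Thm. 5)] -/
def found (a : List Bool → Bool) (y : List Bool) : List Bool :=
  searchZ (D.B₁ R₁ a y) (D.S.m₁ y)

/-- **The search fails on `y`** (under the answers `a`). [cite: ChenEtAl2022, §5.2 (proof of Thm. 5)] -/
def searchFails (a : List Bool → Bool) (y : List Bool) : Bool :=
  !D.S.good₁ y (D.found R₁ a y)

/-- The five probe prefixes of the level-1 search on `y`. [folklore] -/
def probes₁ (a : List Bool → Bool) (y : List Bool) : List (List Bool) :=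
  probes (D.B₁ R₁ a y) (D.S.m₁ y)

/-- **The `j`-th level-1 probe instance** at `y`: the padded query of the `j`-th probe prefix.
[cite: ChenEtAl2022, §5.2 (proof of Thm. 5: the queries made by R^A(y, …), R^A(y∘0, …), R^A(y∘1, …))] -/
def probeInst (a : List Bool → Bool) (y : List Bool) (j : ℕ) : List Bool :=
  D.S.g₁ R₁ y ((D.probes₁ R₁ a y).getD j [])

/-- **Detectably bad inputs** (under the answers `a`): `a` accepts `y` but the `a`-driven witness
search fails, or `a` rejects `y ∈ L`. [cite: ChenEtAl2022, §5.2 (proof of Thm. 5); GutfreundShaltielTashma2007] -/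
def bad₂ (a : List Bool → Bool) (y : List Bool) : Prop :=
  (a y = true ∧ D.searchFails R₁ a y = true) ∨ (a y = false ∧ y ∈ D.L)

/-- An input on which the answers are wrong about `L` is detectably bad. [cite: ChenEtAl2022, §5.2 (proof of Thm. 5)] -/
theorem bad₂_of_not_agree (hS : D.Spec) {a : List Bool → Bool} {y : List Bool}
    (h : ¬ (a y = true ↔ y ∈ D.L)) : D.bad₂ R₁ a y := by
  cases ha : a y
  · right
    refine ⟨ha, ?_⟩
    by_contra hy
    exact h ⟨fun h' => by rw [ha] at h'; exact absurd h' Bool.false_ne_true, fun h' => absurd h' hy⟩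
  · left
    refine ⟨ha, ?_⟩
    have hy : y ∉ D.L := fun hy => h ⟨fun _ => hy, fun _ => ha⟩
    rw [searchFails, Bool.not_eq_true']
    by_contra hg
    rw [Bool.not_eq_false] at hg
    exact hy (D.S.mem_of_good₁ hS.spec (by rw [found, length_searchZ]; rfl) hg)

/-! #### Dependence on the answers only through short queries -/

/-- Two oracles agreeing on all strings of length `≤ m` drive the same search for `k ≤ m` rounds. [folklore] -/
theorem searchZ_congr {B B' : List Bool → Bool} {m : ℕ}
    (h : ∀ w : List Bool, w.length ≤ m → B w = B' w) : ∀ {k : ℕ}, k ≤ m → searchZ B k = searchZ B' k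
  | 0, _ => rfl
  | k + 1, hk => by
    have ih := searchZ_congr h (Nat.le_of_succ_le hk)
    simp only [searchZ, Function.iterate_succ_apply'] at ih ⊢
    rw [ih]
    simp only [stepB]
    rw [h _ (by rw [List.length_append, length_iterate_stepB]; simpa using hk)]

/-- … have the same first inconsistency … [folklore] -/
theorem failIdx_congr {B B' : List Bool → Bool} {m : ℕ}
    (h : ∀ w : List Bool, w.length ≤ m → B w = B' w) : failIdx B m = failIdx B' m := by
  unfold failIdx
  rw [searchZ_congr h le_rfl]
  congr 1
  funext i
  rw [h _ (by rw [List.length_take, length_searchZ]; exact min_le_right _ _),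
    h _ (by rw [List.length_take, length_searchZ]; exact min_le_right _ _)]

/-- … and the same probes. [folklore] -/
theorem probes_congr {B B' : List Bool → Bool} {m : ℕ}
    (h : ∀ w : List Bool, w.length ≤ m + 1 → B w = B' w) : probes B m = probes B' m := by
  have h' : ∀ w : List Bool, w.length ≤ m → B w = B' w := fun w hw => h w (Nat.le_succ_of_le hw)
  unfold probes failPrefix
  rw [searchZ_congr h' le_rfl, failIdx_congr h']

/-- Level-1 objects depend on the answers only through queries `g₁ y z`, `|z| ≤ p|y| + 1`. [folklore] -/
theorem B₁_congr {a a' : List Bool → Bool} {y : List Bool}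
    (h : ∀ z : List Bool, z.length ≤ D.p.eval y.length + 1 → a (D.S.g₁ R₁ y z) = a' (D.S.g₁ R₁ y z)) :
    ∀ w : List Bool, w.length ≤ D.S.m₁ y + 1 → D.B₁ R₁ a y w = D.B₁ R₁ a' y w :=
  fun w hw => h w hw

/-- The found string depends on the answers only through the level-1 queries. [folklore] -/
theorem found_congr {a a' : List Bool → Bool} {y : List Bool}
    (h : ∀ z : List Bool, z.length ≤ D.p.eval y.length + 1 → a (D.S.g₁ R₁ y z) = a' (D.S.g₁ R₁ y z)) :
    D.found R₁ a y = D.found R₁ a' y :=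
  searchZ_congr (fun w hw => D.B₁_congr R₁ h w (Nat.le_succ_of_le hw)) le_rfl

/-- Failure of the search depends on the answers only through the level-1 queries. [folklore] -/
theorem searchFails_congr {a a' : List Bool → Bool} {y : List Bool}
    (h : ∀ z : List Bool, z.length ≤ D.p.eval y.length + 1 → a (D.S.g₁ R₁ y z) = a' (D.S.g₁ R₁ y z)) :
    D.searchFails R₁ a y = D.searchFails R₁ a' y := by
  rw [searchFails, searchFails, D.found_congr R₁ h]

/-- The probe instances depend on the answers only through the level-1 queries. [folklore] -/
theorem probeInst_congr {a a' : List Bool → Bool} {y : List Bool}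
    (h : ∀ z : List Bool, z.length ≤ D.p.eval y.length + 1 → a (D.S.g₁ R₁ y z) = a' (D.S.g₁ R₁ y z))
    (j : ℕ) : D.probeInst R₁ a y j = D.probeInst R₁ a' y j := by
  rw [probeInst, probeInst, probes₁, probes₁, probes_congr (D.B₁_congr R₁ h)]

/-- `bad₂` depends on the answers only through `y` and the level-1 queries at `y`. [folklore] -/
theorem bad₂_congr {a a' : List Bool → Bool} {y : List Bool} (hy : a y = a' y)
    (h : ∀ z : List Bool, z.length ≤ D.p.eval y.length + 1 → a (D.S.g₁ R₁ y z) = a' (D.S.g₁ R₁ y z)) :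
    D.bad₂ R₁ a y ↔ D.bad₂ R₁ a' y := by
  rw [bad₂, bad₂, hy, D.searchFails_congr R₁ h]

/-- Probe prefixes are short. [folklore] -/
theorem length_probe_le (a : List Bool → Bool) (y : List Bool) (j : ℕ) :
    ((D.probes₁ R₁ a y).getD j []).length ≤ D.p.eval y.length + 1 := by
  by_cases hj : j < (D.probes₁ R₁ a y).length
  · rw [List.getD_eq_getElem _ _ hj]
    exact length_le_of_mem_probes _ (List.getElem_mem hj)
  · rw [List.getD_eq_default _ _ (not_lt.1 hj)]
    exact Nat.zero_le _

/-- Probe instances have length exactly `ℓ₁ |y|`. [cite: ChenEtAl2022, §5.1–5.2 (queries padded to length exactly ℓ(n))] -/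
theorem length_probeInst (hS : D.Spec) (a : List Bool → Bool) (y : List Bool) (j : ℕ) :
    (D.probeInst R₁ a y j).length = (D.S.ℓ₁ R₁).eval y.length :=
  D.S.length_g₁ R₁ hS.spec (D.length_probe_le R₁ a y j)

/-! #### The level-1 endgame -/

/-- **The level-1 contradiction.** If `y` is detectably bad under the EXACT answers of `L''`, but
`L''` is right about `L` on `y` and on the five level-1 probe instances at `y`, we reach a
contradiction: `y ∈ L` (it is accepted and `L''` is right on it), so the witness search, whose
oracle agrees with the truth `H₁` on its probes, succeeds (`GSTRefuter.searchZ_sound`).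
[cite: ChenEtAl2022, §5.2 (proof of Thm. 5, correctness of the list-refuter); GutfreundShaltielTashma2007] -/
theorem false_of_correct (hS : D.Spec) {y : List Bool} (hbad : D.bad₂ R₁ D.aT y)
    (hy : (y ∈ D.L'' ↔ y ∈ D.L))
    (hpr : ∀ j, j < 5 → (D.probeInst R₁ D.aT y j ∈ D.L'' ↔ D.probeInst R₁ D.aT y j ∈ D.L)) : False := by
  rcases hbad with ⟨hA, hF⟩ | ⟨hA, hL⟩
  swap
  · have : D.aT y = true := (D.aT_eq_true_iff y).2 (hy.2 hL)
    rw [hA] at this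
    exact Bool.false_ne_true this
  have hyL : y ∈ D.L := hy.1 ((D.aT_eq_true_iff y).1 hA)
  set B := D.B₁ R₁ D.aT y with hB
  have hagree : ∀ z ∈ probes B (D.S.m₁ y),
      (B z = true ↔ ∃ u : List Bool, u.length = D.p.eval y.length ∧ z <+: u ∧ D.S.good₁ y u = true) := by
    intro z hz
    obtain ⟨j, hj, hjz⟩ := List.mem_iff_getElem.1 hz
    have hj5 : j < 5 := by simpa [probes] using hj
    have hzj : (D.probes₁ R₁ D.aT y).getD j [] = z := by
      rw [probes₁, List.getD_eq_getElem _ _ hj, hjz]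
    have hq := hpr j hj5
    rw [probeInst, hzj] at hq
    have hzlen : z.length ≤ D.S.p.eval y.length + 1 := length_le_of_mem_probes _ hz
    rw [hB, B₁, aT_eq_true_iff, hq]
    exact D.S.g₁_mem_iff R₁ hS.spec hzlen
  have hroot : ∃ u : List Bool, u.length = D.p.eval y.length ∧ [] <+: u ∧ D.S.good₁ y u = true := by
    obtain ⟨u, hu, hg⟩ := D.S.exists_good₁_of_mem hS.spec hyL
    exact ⟨u, hu, List.nil_prefix, hg⟩
  have hQ : ∀ z : List Bool, (∃ u : List Bool, u.length = D.p.eval y.length ∧ z <+: u ∧ D.S.good₁ y u = true) →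
      z.length < D.S.m₁ y →
      (∃ u : List Bool, u.length = D.p.eval y.length ∧ z ++ [false] <+: u ∧ D.S.good₁ y u = true) ∨
        (∃ u : List Bool, u.length = D.p.eval y.length ∧ z ++ [true] <+: u ∧ D.S.good₁ y u = true) := by
    rintro z ⟨u, hu, hzu, hug⟩ hlt
    obtain ⟨b, hb⟩ := prefix_append_bit_of_lt hzu (by rw [hu]; exact hlt)
    cases b
    · exact Or.inl ⟨u, hu, hb, hug⟩
    · exact Or.inr ⟨u, hu, hb, hug⟩
  obtain ⟨u, hu, hzu, hug⟩ := searchZ_sound B hQ hagree hroot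
  have huz : u = searchZ B (D.S.m₁ y) := by
    have h := List.prefix_iff_eq_take.1 hzu
    rw [length_searchZ, List.take_of_length_le (by rw [hu]; rfl)] at h
    exact h.symm
  subst huz
  have : D.searchFails R₁ D.aT y = false := by
    rw [searchFails, found, ← hB, hug]; rfl
  rw [this] at hF
  exact Bool.false_ne_true hF

/-! #### Level 1 is polynomial time in the answers' parameters -/

section CodeFP₁

variable {σ : Type} {eσ : σ → List Bool} {af : σ → List Bool → Bool}

/-- The parametrized level-1 oracle bit is polynomial time. [cite: AroraBarak2009, §1.3] -/
theorem codeFP_B₁ (hC : D.Codes) (ha : CodeFP (pairE eσ strE) bitE fun t => af t.1 t.2) :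
    CodeFP (pairE (pairE eσ strE) strE) bitE fun t => D.B₁ R₁ (af t.1.1) t.1.2 t.2 := by
  have hg : CodeFP (pairE (pairE eσ strE) strE) strE (fun t => D.S.g₁ R₁ t.1.2 t.2) :=
    (D.S.codeFP_g₁ R₁ hC.S).comp ((fst _ _).snd'.pair (snd _ _))
  exact (ha.comp ((fst _ _).fst'.pair hg)).congr fun _ => rfl

/-- The parametrized found string is polynomial time. [cite: AroraBarak2009, §1.3] -/
theorem codeFP_found (hC : D.Codes) (ha : CodeFP (pairE eσ strE) bitE fun t => af t.1 t.2) :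
    CodeFP (pairE eσ strE) strE fun t => D.found R₁ (af t.1) t.2 := by
  have hm : CodeFP (pairE eσ strE) unE (fun t => D.S.m₁ t.2) := D.S.codeFP_m₁.comp (snd _ _)
  exact (codeFP_searchZ (D.codeFP_B₁ R₁ hC ha) hm).congr fun _ => rfl

/-- The parametrized failure bit is polynomial time. [cite: ChenEtAl2022, §5.2 (proof of Thm. 5: condition (2) can be checked in polynomial time)] -/
theorem codeFP_searchFails (hC : D.Codes) (ha : CodeFP (pairE eσ strE) bitE fun t => af t.1 t.2) :
    CodeFP (pairE eσ strE) bitE fun t => D.searchFails R₁ (af t.1) t.2 := by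
  have hg : CodeFP (pairE eσ strE) bitE (fun t => D.S.good₁ t.2 (D.found R₁ (af t.1) t.2)) :=
    (D.S.codeFP_good₁ hC.Vb).comp ((snd _ _).pair (D.codeFP_found R₁ hC ha))
  exact hg.not.congr fun _ => rfl

/-- The parametrized probe instances are polynomial time. [cite: AroraBarak2009, §1.3] -/
theorem codeFP_probeInst (hC : D.Codes) (ha : CodeFP (pairE eσ strE) bitE fun t => af t.1 t.2) (j : ℕ) :
    CodeFP (pairE eσ strE) strE fun t => D.probeInst R₁ (af t.1) t.2 j := by
  have hm : CodeFP (pairE eσ strE) unE (fun t => D.S.m₁ t.2) := D.S.codeFP_m₁.comp (snd _ _)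
  have hp : CodeFP (pairE eσ strE) (rawE strE) (fun t => D.probes₁ R₁ (af t.1) t.2) :=
    (codeFP_probes (D.codeFP_B₁ R₁ hC ha) hm).congr fun _ => rfl
  have hz : CodeFP (pairE eσ strE) strE (fun t => (D.probes₁ R₁ (af t.1) t.2).getD j []) :=
    (rawGetD strE (d := ([] : List Bool)) rfl).comp (hp.pair (const _ j))
  exact ((D.S.codeFP_g₁ R₁ hC.S).comp ((snd _ _).pair hz)).congr fun _ => rfl

end CodeFP₁

/-! ### The canonical predicate, path and bad string -/

/-- **The canonical level-2 predicate** at length `n`: some detectably bad (under the EXACT answers)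
`y ∈ {0,1}ⁿ` extends `z`. [cite: ChenEtAl2022, §5.2 (proof of Thm. 5, the NP question "does there exist x … whose prefix is y")] -/
def T (n : ℕ) (z : List Bool) : Prop :=
  ∃ y : List Bool, y.length = n ∧ z <+: y ∧ D.bad₂ R₁ D.aT y

/-- The canonical oracle: the truth of `T`. [folklore] -/
def Bst (n : ℕ) (z : List Bool) : Bool := by
  classical exact decide (D.T R₁ n z)

/-- `Bst n z = true ↔ T n z`. [folklore] -/
theorem Bst_eq_true_iff (n : ℕ) (z : List Bool) : D.Bst R₁ n z = true ↔ D.T R₁ n z := by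
  classical
  simp [Bst]

/-- **The canonical path** after `k` rounds: the truth-driven prefix search. [cite: ChenEtAl2022, §5.2 (proof of Thm. 5, the search-to-decision reduction)] -/
def zst (n k : ℕ) : List Bool :=
  searchZ (D.Bst R₁ n) k

/-- **The canonical bad string** of length `n`. [cite: ChenEtAl2022, §5.2 (proof of Thm. 5, x*)] -/
def yst (n : ℕ) : List Bool :=
  D.zst R₁ n n

/-- `|zst n k| = k`. [folklore] -/
@[simp] theorem length_zst (n k : ℕ) : (D.zst R₁ n k).length = k := length_searchZ _ _

/-- `|yst n| = n`. [folklore] -/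
@[simp] theorem length_yst (n : ℕ) : (D.yst R₁ n).length = n := length_searchZ _ _

/-- The path grows one round at a time. [folklore] -/
theorem zst_succ (n k : ℕ) : D.zst R₁ n (k + 1) = stepB (D.Bst R₁ n) (D.zst R₁ n k) := by
  rw [zst, zst, searchZ, searchZ, Function.iterate_succ_apply']

/-- A bad length makes the root true. [cite: ChenEtAl2022, §5.2 (proof of Thm. 5)] -/
theorem T_nil_of_bad (hS : D.Spec) {n : ℕ} (h : ∃ y : List Bool, y.length = n ∧ (y ∈ D.L ↔ y ∉ D.L'')) :
    D.T R₁ n [] := by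
  obtain ⟨y, hy, hyo⟩ := h
  refine ⟨y, hy, List.nil_prefix, D.bad₂_of_not_agree R₁ hS fun hag => ?_⟩
  rw [aT_eq_true_iff] at hag
  exact iff_not_self (hag.trans hyo)

/-- `T` passes to a one-bit extension of a short prefix. [folklore] -/
theorem T_append_bit {n : ℕ} {z : List Bool} (h : D.T R₁ n z) (hlt : z.length < n) :
    D.T R₁ n (z ++ [false]) ∨ D.T R₁ n (z ++ [true]) := by
  obtain ⟨y, hy, hzy, hyb⟩ := h
  obtain ⟨b, hb⟩ := prefix_append_bit_of_lt hzy (by omega)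
  cases b
  · exact Or.inl ⟨y, hy, hb, hyb⟩
  · exact Or.inr ⟨y, hy, hb, hyb⟩

/-- **The canonical path stays true**: if the root is true then every canonical prefix of length
`k ≤ n` is. [cite: ChenEtAl2022, §5.2 (proof of Thm. 5)] -/
theorem T_zst {n : ℕ} (h0 : D.T R₁ n []) {k : ℕ} (hk : k ≤ n) : D.T R₁ n (D.zst R₁ n k) := by
  induction k with
  | zero => exact h0
  | succ k ihk =>
    have ih := ihk (Nat.le_of_succ_le hk)
    rw [zst_succ, stepB]
    cases hb : D.Bst R₁ n (D.zst R₁ n k ++ [false])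
    · have hnot : ¬ D.T R₁ n (D.zst R₁ n k ++ [false]) := fun h => by
        rw [← Bst_eq_true_iff, hb] at h; exact Bool.false_ne_true h
      rcases D.T_append_bit R₁ ih (by rw [length_zst]; omega) with h | h
      · exact absurd h hnot
      · simpa using h
    · simpa using (D.Bst_eq_true_iff R₁ n _).1 hb

/-- **The canonical string is detectably bad** at a bad length. [cite: ChenEtAl2022, §5.2 (proof of Thm. 5)] -/
theorem bad₂_yst (hS : D.Spec) {n : ℕ} (h : ∃ y : List Bool, y.length = n ∧ (y ∈ D.L ↔ y ∉ D.L'')) :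
    D.bad₂ R₁ D.aT (D.yst R₁ n) := by
  obtain ⟨y, hy, hzy, hyb⟩ := D.T_zst R₁ (D.T_nil_of_bad R₁ hS h) le_rfl
  have : y = D.yst R₁ n := by
    have h := List.prefix_iff_eq_take.1 hzy
    rw [length_zst, List.take_of_length_le (by rw [hy])] at h
    exact h.symm
  subst this
  exact hyb

/-! ### Level 2: the coin-carrying bad-prefix language -/

/-- **The bad-prefix language with coins in the instance**:
`⟨⟨u, c⟩, z⟩ ∈ H₂ ↔ ∃ y ∈ {0,1}^{|u|}, z ⊑ y, bad₂ (A'(·, c)) y` — the `NP` question of the printed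
level-2 search asked about the DETERMINISTIC predicate `A'(·, c)`. [cite: ChenEtAl2022, §5.2 (proof of Thm. 5) with §5.1 (proof of Thm. 4, case 𝒞 = BPP)] -/
def H₂ : Language Bool :=
  {w | ∃ y : List Bool, y.length = (fstF (fstF w)).length ∧ sndF w <+: y ∧
    D.bad₂ R₁ (fun x => D.amp x (sndF (fstF w))) y}

/-- Membership of a coded triple in `H₂`. [folklore] -/
theorem boolPair_mem_H₂ (n : ℕ) (c z : List Bool) :
    boolPair (boolPair (unE n) c) z ∈ D.H₂ R₁ ↔
      ∃ y : List Bool, y.length = n ∧ z <+: y ∧ D.bad₂ R₁ (fun x => D.amp x c) y := by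
  change (∃ y : List Bool, y.length = (fstF (fstF (boolPair (boolPair (unE n) c) z))).length ∧
    sndF (boolPair (boolPair (unE n) c) z) <+: y ∧
      D.bad₂ R₁ (fun x => D.amp x (sndF (fstF (boolPair (boolPair (unE n) c) z)))) y) ↔ _
  rw [fstF_boolPair, sndF_boolPair, fstF_boolPair, sndF_boolPair, length_unE]

/-- The certificate test of `H₂`: on `⟨⟨⟨u, c⟩, z⟩, ⟨y, v⟩⟩`, `|y| = |u|`, `z ⊑ y`, and either
`A'(y,c) ∧ searchFails (A'(·,c)) y`, or `¬A'(y,c)` and `v` is a good string of length `p|y|` for `y`. [folklore] -/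
def chk₂ (w : List Bool) : Bool :=
  decide ((fstF (sndF w)).length = (fstF (fstF (fstF w))).length) &&
    decide (sndF (fstF w) <+: fstF (sndF w)) &&
    (D.amp (fstF (sndF w)) (sndF (fstF (fstF w))) &&
        D.searchFails R₁ (fun x => D.amp x (sndF (fstF (fstF w)))) (fstF (sndF w)) ||
      !D.amp (fstF (sndF w)) (sndF (fstF (fstF w))) &&
        decide ((sndF (sndF w)).length = D.p.eval (fstF (sndF w)).length) &&
        D.S.good₁ (fstF (sndF w)) (sndF (sndF w)))

/-- The certificate test of `H₂` is polynomial time. [cite: AroraBarak2009, §1.3] -/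
theorem codeFP_chk₂ (hC : D.Codes) : CodeFP strE bitE (D.chk₂ R₁) := by
  have F : CodeFP strE strE fstF := of_fn fstF fstF_mem_FP fun _ => rfl
  have G : CodeFP strE strE sndF := of_fn sndF sndF_mem_FP fun _ => rfl
  have u : CodeFP strE strE (fun w => fstF (fstF (fstF w))) := F.comp (F.comp F)
  have c : CodeFP strE strE (fun w => sndF (fstF (fstF w))) := G.comp (F.comp F)
  have z : CodeFP strE strE (fun w => sndF (fstF w)) := G.comp F
  have y : CodeFP strE strE (fun w => fstF (sndF w)) := F.comp G
  have v : CodeFP strE strE (fun w => sndF (sndF w)) := G.comp G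
  have ha : CodeFP (pairE strE strE) bitE (fun t => D.amp t.2 t.1) := (D.codeFP_amp hC).comp ((snd _ _).pair (fst _ _))
  have t1 : CodeFP strE bitE (fun w => decide ((fstF (sndF w)).length = (fstF (fstF (fstF w))).length)) :=
    (CodeFP.eq unE_injective).comp ((strLength.comp y).pair (strLength.comp u))
  have t2 : CodeFP strE bitE (fun w => decide (sndF (fstF w) <+: fstF (sndF w))) := codeFP_isPrefix.comp (z.pair y)
  have a : CodeFP strE bitE (fun w => D.amp (fstF (sndF w)) (sndF (fstF (fstF w)))) :=
    (D.codeFP_amp hC).comp (y.pair c)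
  have hsf : CodeFP (pairE strE strE) bitE (fun t => D.searchFails R₁ (fun x => D.amp x t.1) t.2) :=
    D.codeFP_searchFails R₁ hC (af := fun c x => D.amp x c) ha
  -- (elaborate the composition without expected type: its inner argument depends on the input)
  have hf := hsf.comp (c.pair y)
  have f : CodeFP strE bitE (fun w => D.searchFails R₁ (fun x => D.amp x (sndF (fstF (fstF w)))) (fstF (sndF w))) :=
    hf.congr fun _ => rfl
  have t3 : CodeFP strE bitE (fun w => decide ((sndF (sndF w)).length = D.p.eval (fstF (sndF w)).length)) :=
    (CodeFP.eq unE_injective).comp ((strLength.comp v).pair ((codeFP_unPoly D.p).comp (strLength.comp y)))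
  have g : CodeFP strE bitE (fun w => D.S.good₁ (fstF (sndF w)) (sndF (sndF w))) :=
    (D.S.codeFP_good₁ hC.Vb).comp (y.pair v)
  have h₁ : CodeFP strE bitE (fun w => D.amp (fstF (sndF w)) (sndF (fstF (fstF w))) &&
      D.searchFails R₁ (fun x => D.amp x (sndF (fstF (fstF w)))) (fstF (sndF w))) := (a.and f).congr fun _ => rfl
  have h₂ : CodeFP strE bitE (fun w => !D.amp (fstF (sndF w)) (sndF (fstF (fstF w))) &&
      decide ((sndF (sndF w)).length = D.p.eval (fstF (sndF w)).length) &&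
        D.S.good₁ (fstF (sndF w)) (sndF (sndF w))) := ((a.not.and t3).and g).congr fun _ => rfl
  exact ((t1.and t2).and (h₁.or h₂)).congr fun _ => rfl

/-- **`H₂ ∈ NP`** (certificate: the bad `y`, and in the rejecting case a witness of `y ∈ L`).
[cite: ChenEtAl2022, §5.2 (proof of Thm. 5)] -/
theorem H₂_mem_NP (hS : D.Spec) (hC : D.Codes) : D.H₂ R₁ ∈ Nondeterministic.NP := by
  refine memNP_of_codeFP (2 * X + 2 + D.p) (D.codeFP_chk₂ R₁ hC) fun w => ⟨?_, ?_⟩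
  · rintro ⟨y, hy, hxy, hbad⟩
    have hyw : y.length ≤ w.length := by
      have h1 := length_fstF_sndF_le w
      have h2 := length_fstF_sndF_le (fstF w)
      omega
    rcases hbad with ⟨hA, hF⟩ | ⟨hA, hL⟩
    · refine ⟨boolPair y [], ?_, ?_⟩
      · rw [length_boolPair]; simp; omega
      · simp [chk₂, hy, hxy, hA, hF]
    · obtain ⟨u, hu, hg⟩ := D.S.exists_good₁_of_mem hS.spec hL
      refine ⟨boolPair y u, ?_, ?_⟩
      · rw [length_boolPair, hu]
        have := TM2Iter.eval_mono D.p hyw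
        simp; omega
      · simp [chk₂, hy, hxy, hA, hu, hg]
  · rintro ⟨cert, -, hc⟩
    simp only [chk₂, fstF_boolPair, sndF_boolPair, Bool.and_eq_true, Bool.or_eq_true, decide_eq_true_eq,
      Bool.not_eq_true'] at hc
    obtain ⟨⟨hy, hxy⟩, hcase⟩ := hc
    refine ⟨fstF cert, hy, hxy, ?_⟩
    rcases hcase with ⟨hA, hF⟩ | ⟨⟨hA, hu⟩, hg⟩
    · exact Or.inl ⟨hA, hF⟩
    · exact Or.inr ⟨hA, D.S.mem_of_good₁ hS.spec hu.le hg⟩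

end Level1

/-! ### Level-2 instances of prescribed length -/

section Level2

variable (R₁ : Red D.S.H₁ D.L) (R₂ : Red (D.H₂ R₁) D.L)

/-- The length of the coin block carried by the instances at stage `n`: `q(ℓ₁(n))` coins, enough for
`A'` on all inputs of length `≤ ℓ₁(n)`. [cite: ChenEtAl2022, §5.1 (proof of Thm. 4, case 𝒞 = BPP)] -/
def βr : Polynomial ℕ :=
  D.q.comp (D.S.ℓ₁ R₁)

/-- A bound on the length of the reduced level-2 queries at stage `n`. [folklore] -/
def C₂ : Polynomial ℕ :=
  R₂.P.comp (5 * X + 7 + 2 * D.βr R₁)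

/-- **The base length `P(n)` of the depth-indexed level-2 instances**: at least the natural length
`C₂(n)` of every reduced query, and with gaps `P(n+1) - P(n) > n`, so that `m = P(n) + k`, `k < n`,
determines `(n, k)`. [cite: ChenEtAl2022, §5.1 (proof of Lemma 6: the length functions ℓ^(i) are strictly increasing, hence injective)] -/
def P : Polynomial ℕ :=
  X ^ 2 + X + D.C₂ R₁ R₂

/-- **The level-2 instance of depth target length `m`**: the reduced coin-carrying query
`⟨⟨1ⁿ, c⟩, z⟩ ∈ H₂?`, padded to length exactly `m`. [cite: ChenEtAl2022, §5.2 (proof of Thm. 5) with §5.1 (queries of prescribed length)] -/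
def inst (n : ℕ) (c z : List Bool) (m : ℕ) : List Bool :=
  D.pad (R₂.r (boolPair (boolPair (unE n) c) z), m)

/-- `P` evaluates as `n² + n + C₂(n)`. [folklore] -/
theorem P_eval (n : ℕ) : (D.P R₁ R₂).eval n = n ^ 2 + n + (D.C₂ R₁ R₂).eval n := by
  simp [P]

/-- `n ≤ P(n)`. [folklore] -/
theorem le_P (n : ℕ) : n ≤ (D.P R₁ R₂).eval n := by
  rw [P_eval]; omega

/-- `C₂(n) ≤ P(n)`. [folklore] -/
theorem C₂_le_P (n : ℕ) : (D.C₂ R₁ R₂).eval n ≤ (D.P R₁ R₂).eval n := by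
  rw [P_eval]; omega

/-- **The gaps of `P` exceed `n`**: `P(n) + n < P(n + 1)`. [folklore] -/
theorem P_add_lt (n : ℕ) : (D.P R₁ R₂).eval n + n < (D.P R₁ R₂).eval (n + 1) := by
  rw [P_eval, P_eval]
  have := TM2Iter.eval_mono (D.C₂ R₁ R₂) (Nat.le_succ n)
  nlinarith

/-- `P` is strictly increasing. [folklore] -/
theorem strictMono_P : StrictMono fun n => (D.P R₁ R₂).eval n :=
  strictMono_nat_of_lt_succ fun n => by have := D.P_add_lt R₁ R₂ n; omega

/-- The reduced level-2 queries are no longer than `C₂(n)`. [folklore] -/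
theorem length_r₂_le {n : ℕ} {c z : List Bool} (hc : c.length ≤ (D.βr R₁).eval n) (hz : z.length ≤ n + 1) :
    (R₂.r (boolPair (boolPair (unE n) c) z)).length ≤ (D.C₂ R₁ R₂).eval n := by
  have h1 := R₂.length_le (boolPair (boolPair (unE n) c) z)
  have h2 : (boolPair (boolPair (unE n) c) z).length ≤ (5 * X + 7 + 2 * D.βr R₁ : Polynomial ℕ).eval n := by
    rw [length_boolPair, length_boolPair, length_unE]
    simp; omega
  have h3 := TM2Iter.eval_mono R₂.P h2
  rw [C₂, eval_comp]
  exact h1.trans h3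

/-- **Instances have the prescribed length** `m ≥ P(n)`. [cite: ChenEtAl2022, §5.1 (queries padded to prescribed length)] -/
theorem length_inst (hS : D.Spec) {n : ℕ} {c z : List Bool} (hc : c.length ≤ (D.βr R₁).eval n)
    (hz : z.length ≤ n + 1) {m : ℕ} (hm : (D.P R₁ R₂).eval n ≤ m) : (D.inst R₁ R₂ n c z m).length = m :=
  hS.spec.pad_length _ _ (((D.length_r₂_le R₁ R₂ hc hz).trans (D.C₂_le_P R₁ R₂ n)).trans hm)

/-- Padding preserves membership (restated on the data). [folklore] -/
theorem pad_mem (hS : D.Spec) (x : List Bool) (m : ℕ) (h : x.length ≤ m) : D.pad (x, m) ∈ D.L ↔ x ∈ D.L :=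
  hS.spec.pad_mem x m h

/-- **What an instance asks**: `inst n c z m ∈ L ↔ ∃ y ∈ {0,1}ⁿ, z ⊑ y, bad₂ (A'(·, c)) y`.
[cite: ChenEtAl2022, §5.2 (proof of Thm. 5)] -/
theorem inst_mem_iff (hS : D.Spec) {n : ℕ} {c z : List Bool} (hc : c.length ≤ (D.βr R₁).eval n)
    (hz : z.length ≤ n + 1) {m : ℕ} (hm : (D.P R₁ R₂).eval n ≤ m) :
    D.inst R₁ R₂ n c z m ∈ D.L ↔ ∃ y : List Bool, y.length = n ∧ z <+: y ∧ D.bad₂ R₁ (fun x => D.amp x c) y := by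
  rw [inst, D.pad_mem hS _ _ (((D.length_r₂_le R₁ R₂ hc hz).trans (D.C₂_le_P R₁ R₂ n)).trans hm),
    ← R₂.reduces, boolPair_mem_H₂]

/-- The instance map is polynomial time. [cite: AroraBarak2009, §1.3] -/
theorem codeFP_inst (hC : D.Codes) :
    CodeFP (pairE (pairE unE strE) (pairE strE unE)) strE fun t => D.inst R₁ R₂ t.1.1 t.1.2 t.2.1 t.2.2 := by
  have hn : CodeFP (pairE (pairE unE strE) (pairE strE unE)) unE (fun t => t.1.1) := (fst _ _).fst'
  have hc : CodeFP (pairE (pairE unE strE) (pairE strE unE)) strE (fun t => t.1.2) := (fst _ _).snd'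
  have hz : CodeFP (pairE (pairE unE strE) (pairE strE unE)) strE (fun t => t.2.1) := (snd _ _).fst'
  have hm : CodeFP (pairE (pairE unE strE) (pairE strE unE)) unE (fun t => t.2.2) := (snd _ _).snd'
  have hw : CodeFP (pairE (pairE unE strE) (pairE strE unE)) strE (fun t => boolPair (boolPair (unE t.1.1) t.1.2) t.2.1) :=
    (((hn.pair hc).recodeOut fun _ => rfl).pair hz).recodeOut fun _ => rfl
  have hr : CodeFP (pairE (pairE unE strE) (pairE strE unE)) strE (fun t => R₂.r (boolPair (boolPair (unE t.1.1) t.1.2) t.2.1)) :=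
    R₂.codeFP.comp hw
  exact (hC.pad.comp (hr.pair hm)).congr fun _ => rfl

/-! #### Transfer to the exact answers on good coins -/

/-- `n ≤ ℓ₁(n)`. [folklore] -/
theorem le_ℓ₁ (n : ℕ) : n ≤ (D.S.ℓ₁ R₁).eval n :=
  le_eval_X_add _ n

/-- On a coin block good for lengths `n … ℓ₁(n)`, detectable badness under `A'(·, c)` is
detectable badness under the exact answers (for `|y| = n`). [cite: ChenEtAl2022, §5.1 (proof of Thm. 4: A'(·, r) decides the same language as A)] -/
theorem bad₂_amp_iff {n : ℕ} {c : List Bool} (hS : D.Spec) (hc : D.CoinGood n ((D.S.ℓ₁ R₁).eval n) c)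
    {y : List Bool} (hy : y.length = n) : D.bad₂ R₁ (fun x => D.amp x c) y ↔ D.bad₂ R₁ D.aT y := by
  refine D.bad₂_congr R₁ (D.amp_eq_aT hc (by rw [hy]) (by rw [hy]; exact D.le_ℓ₁ R₁ n)) fun z hz => ?_
  have hlen : (D.S.g₁ R₁ y z).length = (D.S.ℓ₁ R₁).eval n := by rw [← hy]; exact D.S.length_g₁ R₁ hS.spec hz
  exact D.amp_eq_aT hc (by rw [hlen]; exact D.le_ℓ₁ R₁ n) (by rw [hlen])

/-- **On good coins an instance asks the canonical question**: `inst n c z m ∈ L ↔ T n z`.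
[cite: ChenEtAl2022, §5.2 (proof of Thm. 5)] -/
theorem inst_mem_iff_T (hS : D.Spec) {n : ℕ} {c z : List Bool} (hgood : D.CoinGood n ((D.S.ℓ₁ R₁).eval n) c)
    (hc : c.length ≤ (D.βr R₁).eval n) (hz : z.length ≤ n + 1) {m : ℕ} (hm : (D.P R₁ R₂).eval n ≤ m) :
    D.inst R₁ R₂ n c z m ∈ D.L ↔ D.T R₁ n z := by
  rw [D.inst_mem_iff R₁ R₂ hS hc hz hm, T]
  refine exists_congr fun y => ⟨?_, ?_⟩
  · rintro ⟨hy, hzy, hb⟩; exact ⟨hy, hzy, (D.bad₂_amp_iff R₁ hS hgood hy).1 hb⟩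
  · rintro ⟨hy, hzy, hb⟩; exact ⟨hy, hzy, (D.bad₂_amp_iff R₁ hS hgood hy).2 hb⟩

/-- On a coin block good for lengths `n … ℓ₁(n)`, the probe instances under `A'(·, c)` at `|y| = n`
are the canonical ones. [folklore] -/
theorem probeInst_amp_eq {n : ℕ} {c : List Bool} (hS : D.Spec) (hc : D.CoinGood n ((D.S.ℓ₁ R₁).eval n) c)
    {y : List Bool} (hy : y.length = n) (j : ℕ) : D.probeInst R₁ (fun x => D.amp x c) y j = D.probeInst R₁ D.aT y j := by
  refine D.probeInst_congr R₁ (fun z hz => ?_) j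
  have hlen : (D.S.g₁ R₁ y z).length = (D.S.ℓ₁ R₁).eval n := by rw [← hy]; exact D.S.length_g₁ R₁ hS.spec hz
  exact D.amp_eq_aT hc (by rw [hlen]; exact D.le_ℓ₁ R₁ n) (by rw [hlen])

end Level2

/-! ### Good coin blocks are likely -/

/-- The amplified bit reads a cylinder event of its coin block. [folklore] -/
theorem amp_eq_true_iff (x c : List Bool) :
    D.amp x c = true ↔ boolPair x (c.take (D.q.eval x.length)) ∈ D.Lamp :=
  (Set.mem_iff_boolIndicator _ _).symm

/-- At one length `ℓ`: the coin blocks on which `A'` errs on SOME input of length `ℓ` have probability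
`≤ 2^ℓ · 2^{-ℓ²}` (union over the `2^ℓ` inputs, each a cylinder of probability `≤ 2^{-ℓ²}`).
[cite: GutfreundShaltielTashma2007, Lemma 4.4 (Adleman's argument)] -/
theorem uniformProb_exists_wrong_le (hS : D.Spec) {ℓ len : ℕ} (hlen : D.q.eval ℓ ≤ len) :
    uniformProb len {c | ∃ x : List Bool, x.length = ℓ ∧ ¬ (D.amp x c = true ↔ x ∈ D.L'')} ≤
      2 ^ ℓ * (1 / 2 ^ (ℓ ^ 2)) := by
  classical
  have hset : {c : List Bool | ∃ x : List Bool, x.length = ℓ ∧ ¬ (D.amp x c = true ↔ x ∈ D.L'')} =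
      ⋃ v ∈ (Finset.univ : Finset (List.Vector Bool ℓ)), {c | ¬ (D.amp v.toList c = true ↔ v.toList ∈ D.L'')} := by
    ext c
    simp only [Set.mem_setOf_eq, Set.mem_iUnion, Finset.mem_univ, exists_true_left]
    constructor
    · rintro ⟨x, hx, h⟩; exact ⟨⟨x, hx⟩, h⟩
    · rintro ⟨v, h⟩; exact ⟨v.toList, v.toList_length, h⟩
  rw [hset]
  refine (uniformProb_biUnion_le len _ _).trans ?_
  have hx : ∀ v : List.Vector Bool ℓ,
      uniformProb len {c | ¬ (D.amp v.toList c = true ↔ v.toList ∈ D.L'')} ≤ 1 / 2 ^ (ℓ ^ 2) := by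
    intro v
    have hv : v.toList.length = ℓ := v.toList_length
    have hcyl : {c : List Bool | ¬ (D.amp v.toList c = true ↔ v.toList ∈ D.L'')} =
        {c | c.take (D.q.eval ℓ) ∈ {y : List Bool | ¬ (boolPair v.toList y ∈ D.Lamp ↔ v.toList ∈ D.L'')}} := by
      ext c
      simp only [Set.mem_setOf_eq, amp_eq_true_iff, hv]
    rw [hcyl, uniformProb_take_of_le hlen]
    have h := hS.amp v.toList
    rwa [hv] at h
  calc ∑ v ∈ (Finset.univ : Finset (List.Vector Bool ℓ)), uniformProb len {c | ¬ (D.amp v.toList c = true ↔ v.toList ∈ D.L'')}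
      ≤ ∑ _v ∈ (Finset.univ : Finset (List.Vector Bool ℓ)), (1 : ℝ) / 2 ^ (ℓ ^ 2) := Finset.sum_le_sum fun v _ => hx v
    _ = 2 ^ ℓ * (1 / 2 ^ (ℓ ^ 2)) := by
      rw [Finset.sum_const, Finset.card_univ, card_vector, Fintype.card_bool, nsmul_eq_mul]; push_cast; ring

/-- `2^ℓ · 2^{-ℓ²} ≤ 2^{-ℓ}` for `ℓ ≥ 2`. [folklore] -/
theorem two_pow_mul_inv_le {ℓ : ℕ} (hℓ : 2 ≤ ℓ) : (2 : ℝ) ^ ℓ * (1 / 2 ^ (ℓ ^ 2)) ≤ (1 / 2) ^ ℓ := by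
  have h : ℓ + ℓ ≤ ℓ ^ 2 := by nlinarith
  rw [mul_one_div, one_div_pow, div_le_div_iff₀ (by positivity) (by positivity), one_mul, ← pow_add]
  exact pow_le_pow_right₀ (by norm_num) h

/-- **Good coin blocks are likely**: a uniform block of length `≥ q(hi)` fails to be good for the
window `lo … hi` (`lo ≥ 2`) with probability `≤ 2 · 2^{-lo}` (union over the lengths, geometric sum).
[cite: ChenEtAl2022, §5.1 (proof of Thm. 4: "with 1 - 2^{-n} probability"); GutfreundShaltielTashma2007, Lemma 4.4] -/
theorem uniformProb_not_coinGood_le (hS : D.Spec) {lo hi len : ℕ} (hlo : 2 ≤ lo) (hlen : D.q.eval hi ≤ len) :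
    uniformProb len {c | ¬ D.CoinGood lo hi c} ≤ 2 * (1 / 2) ^ lo := by
  classical
  have hset : {c : List Bool | ¬ D.CoinGood lo hi c} =
      ⋃ ℓ ∈ Finset.Ico lo (hi + 1), {c | ∃ x : List Bool, x.length = ℓ ∧ ¬ (D.amp x c = true ↔ x ∈ D.L'')} := by
    ext c
    simp only [CoinGood, Set.mem_setOf_eq, Set.mem_iUnion, Finset.mem_Ico, not_forall, exists_prop]
    constructor
    · rintro ⟨x, h1, h2, h⟩; exact ⟨x.length, ⟨h1, Nat.lt_succ_of_le h2⟩, x, rfl, h⟩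
    · rintro ⟨ℓ, ⟨h1, h2⟩, x, hx, h⟩; exact ⟨x, hx ▸ h1, by rw [hx]; exact Nat.le_of_lt_succ h2, h⟩
  rw [hset]
  refine (uniformProb_biUnion_le len _ _).trans ?_
  have hterm : ∀ ℓ ∈ Finset.Ico lo (hi + 1),
      uniformProb len {c | ∃ x : List Bool, x.length = ℓ ∧ ¬ (D.amp x c = true ↔ x ∈ D.L'')} ≤ (1 / 2 : ℝ) ^ ℓ := by
    intro ℓ hℓ
    rw [Finset.mem_Ico] at hℓ
    have hq : D.q.eval ℓ ≤ len := (TM2Iter.eval_mono D.q (Nat.le_of_lt_succ hℓ.2)).trans hlen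
    exact (D.uniformProb_exists_wrong_le hS hq).trans (two_pow_mul_inv_le (hlo.trans hℓ.1))
  refine (Finset.sum_le_sum hterm).trans ?_
  by_cases h : lo ≤ hi + 1
  · rw [geom_sum_Ico (by norm_num) h]
    have h1 : (0 : ℝ) ≤ (1 / 2) ^ (hi + 1) := by positivity
    have h2 : ((1 / 2 : ℝ) ^ (hi + 1) - (1 / 2) ^ lo) / (1 / 2 - 1) = 2 * (1 / 2) ^ lo - 2 * (1 / 2) ^ (hi + 1) := by ring
    rw [h2]
    linarith
  · rw [Finset.Ico_eq_empty (by omega), Finset.sum_empty]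
    positivity

end Data

end BPPNPRefuter

end Literature.Computability.MetaComplexity

end

/-!
## Part II: the walk and the candidate refuters

Part II of the proof of `constructiveSeparation_of_not_subset_BPP_NP` ([ChenEtAl2022], Thm. 1.2 for `(𝒞, 𝒟) = (BPP, NP)`;
§5.2, Thm. 5, with the amplification step of §5.1, Thm. 4). On top of the coin-carrying two-level
search of Part I this part defines the randomized level-2 search
("the walk") and the eight candidate refuters of the proof, as string functions of the unary input
`1ᵐ` and the coin string `ω`, proves them polynomial time (`CodeFP`), and proves how they behave on
GOOD coins.

* Coins. `ω = s r r'₀ r'₁ …`: an evaluation block `s = sOf n ω` of length `βs(n) = q(Bnd(n))`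
  (`Bnd(n) = P(n) + n + ℓ₁(n)` bounds every evaluated length), an instance block `r = rOf n ω` of length
  `βr(n)`, and sample blocks `r'ᵢ = smp n ω i` of length `βr(n)`.
* The walk (`wB`, `zh`). Depth `k` asks the coin-carrying instance of the query `z_k 0` at its OWN
  length `P(n) + k` — `wB n s r w = A'(inst n r w (P(n) + |w| - 1), s)` — and `zh n s r k` is the
  `GSTRefuter.searchZ` prefix search driven by these answers. On good coins (`s` good for the window
  `n … Bnd(n)`, `r` good for `n … ℓ₁(n)`, and `L''` right on the canonical instances of `r` below depth
  `k`) the walk IS the canonical path: `zh_eq_zst`.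
* The candidates. `outM b` (on `m = P(n) + k`: walk `k` steps, then print the first sample instance of
  the current query answered `b`), `outY` (on `m = n`: print the walk's end point), `outJ j` (on
  `m = ℓ₁(n)`: print the `j`-th level-1 probe instance at the walk's end point); the decoders `decM`,
  `decJ` of the input length; polynomial time: `codeFP_outM`, `codeFP_outY`, `codeFP_outJ`; behaviour
  on good coins: `outM_err` (a sample answered wrongly is a counterexample of length `m`), `outY_eq`,
  `outJ_eq`.

## References

* [ChenEtAl2022] L. Chen, C. Jin, R. Santhanam, R. Williams, FOCS 2021 / arXiv:2203.14379v5,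
  §5.1 (Algorithm 1; proof of Lemma 6: the refuter `B^{(i)}` recovers `n` from its input length),
  §5.2 (proof of Thm. 5).
* [AroraBarakCC2009] S. Arora, B. Barak, *Computational Complexity*, CUP 2009, §1.3, §7.4.1.
-/

noncomputable section

namespace Literature.Computability.MetaComplexity

open _root_.Computability Complexity Filter Polynomial Brick CodeFP GSTRefuter

namespace BPPNPRefuter

namespace Data

variable (D : Data) (R₁ : Red D.S.H₁ D.L) (R₂ : Red (D.H₂ R₁) D.L)

/-! ### Block lengths and coin parsing -/

/-- A bound on every length at which stage `n` evaluates the amplified decider: `P(n) + n + ℓ₁(n)`. [folklore] -/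
def Bnd : Polynomial ℕ :=
  D.P R₁ R₂ + X + D.S.ℓ₁ R₁

/-- The length of the evaluation block: `q(Bnd(n))` coins. [cite: ChenEtAl2022, §5.1 (proof of Thm. 4, case 𝒞 = BPP)] -/
def βs : Polynomial ℕ :=
  D.q.comp (D.Bnd R₁ R₂)

/-- `Bnd(n) = P(n) + n + ℓ₁(n)`. [folklore] -/
theorem Bnd_eval (n : ℕ) : (D.Bnd R₁ R₂).eval n = (D.P R₁ R₂).eval n + n + (D.S.ℓ₁ R₁).eval n := by
  simp [Bnd]

/-- The evaluation block of the coin string. [folklore] -/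
def sOf (n : ℕ) (ω : List Bool) : List Bool :=
  ω.take ((D.βs R₁ R₂).eval n)

/-- The instance block of the coin string. [folklore] -/
def rOf (n : ℕ) (ω : List Bool) : List Bool :=
  (ω.drop ((D.βs R₁ R₂).eval n)).take ((D.βr R₁).eval n)

/-- The `i`-th sample block of the coin string. [folklore] -/
def smp (n : ℕ) (ω : List Bool) (i : ℕ) : List Bool :=
  ((ω.drop ((D.βs R₁ R₂).eval n + (D.βr R₁).eval n)).drop (i * (D.βr R₁).eval n)).take ((D.βr R₁).eval n)

/-- `|rOf n ω| ≤ βr(n)`. [folklore] -/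
theorem length_rOf_le (n : ℕ) (ω : List Bool) : (D.rOf R₁ R₂ n ω).length ≤ (D.βr R₁).eval n := by
  rw [rOf, List.length_take]; exact min_le_left _ _

/-- `|smp n ω i| ≤ βr(n)`. [folklore] -/
theorem length_smp_le (n : ℕ) (ω : List Bool) (i : ℕ) : (D.smp R₁ R₂ n ω i).length ≤ (D.βr R₁).eval n := by
  rw [smp, List.length_take]; exact min_le_left _ _

/-! ### The walk -/

/-- **The walk's oracle bit**: the query `w` (`= z0` at depth `|z|`) is asked through the coin-carrying
instance of `r` at its own length `P(n) + |w| - 1`, and the amplified decider is evaluated on it with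
the evaluation block `s`. [cite: ChenEtAl2022, §5.1 (Algorithm 1) and §5.2 (proof of Thm. 5)] -/
def wB (n : ℕ) (s r : List Bool) (w : List Bool) : Bool :=
  D.amp (D.inst R₁ R₂ n r w ((D.P R₁ R₂).eval n + (w.length - 1))) s

/-- **The walk**: `k` rounds of the prefix search driven by `wB`. [cite: ChenEtAl2022, §5.1 (Algorithm 1)] -/
def zh (n : ℕ) (s r : List Bool) (k : ℕ) : List Bool :=
  searchZ (D.wB R₁ R₂ n s r) k

/-- `|zh n s r k| = k`. [folklore] -/
@[simp] theorem length_zh (n : ℕ) (s r : List Bool) (k : ℕ) : (D.zh R₁ R₂ n s r k).length = k :=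
  length_searchZ _ _

/-- **`L''` is right on the canonical instances of `r` below depth `k`.** [folklore] -/
def RC (n : ℕ) (r : List Bool) (k : ℕ) : Prop :=
  ∀ i, i < k → (D.inst R₁ R₂ n r (D.zst R₁ n i ++ [false]) ((D.P R₁ R₂).eval n + i) ∈ D.L'' ↔
    D.T R₁ n (D.zst R₁ n i ++ [false]))

/-- `RC` is monotone in the depth. [folklore] -/
theorem RC.mono {D : Data} {R₁ : Red D.S.H₁ D.L} {R₂ : Red (D.H₂ R₁) D.L} {n : ℕ} {r : List Bool} {k k' : ℕ}
    (h : D.RC R₁ R₂ n r k) (hk : k' ≤ k) : D.RC R₁ R₂ n r k' :=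
  fun i hi => h i (lt_of_lt_of_le hi hk)

/-- **On good coins the walk is the canonical path.** If `s` is good for the lengths `n … Bnd(n)` and
`L''` is right on the canonical instances of `r` below depth `k ≤ n`, then `zh n s r k = zst n k`.
[cite: ChenEtAl2022, §5.2 (proof of Thm. 5)] -/
theorem zh_eq_zst (hS : D.Spec) {n : ℕ} {s r : List Bool} (hs : D.CoinGood n ((D.Bnd R₁ R₂).eval n) s)
    (hr : r.length ≤ (D.βr R₁).eval n) {k : ℕ} (hk : k ≤ n) (hRC : D.RC R₁ R₂ n r k) :
    D.zh R₁ R₂ n s r k = D.zst R₁ n k := by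
  induction k with
  | zero => rfl
  | succ k ih =>
    have ih' := ih (Nat.le_of_succ_le hk) (hRC.mono (Nat.le_succ k))
    rw [zh, zst, searchZ, searchZ, Function.iterate_succ_apply', Function.iterate_succ_apply']
    change stepB (D.wB R₁ R₂ n s r) (D.zh R₁ R₂ n s r k) = stepB (D.Bst R₁ n) (D.zst R₁ n k)
    rw [ih', stepB, stepB]
    -- the oracle bits agree on the canonical query of depth `k`
    have hlen : ((D.P R₁ R₂).eval n + ((D.zst R₁ n k ++ [false]).length - 1)) = (D.P R₁ R₂).eval n + k := by
      rw [List.length_append, length_zst]; rfl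
    have hw : (D.zst R₁ n k ++ [false]).length ≤ n + 1 := by rw [List.length_append, length_zst]; simp; omega
    have hil := D.length_inst R₁ R₂ hS hr hw (m := (D.P R₁ R₂).eval n + k) (Nat.le_add_right _ _)
    have key : D.wB R₁ R₂ n s r (D.zst R₁ n k ++ [false]) = D.Bst R₁ n (D.zst R₁ n k ++ [false]) := by
      rw [wB, hlen, Bool.eq_iff_iff, hs _ (by rw [hil]; exact le_add_right (D.le_P R₁ R₂ n))
        (by rw [hil, Bnd_eval]; omega), hRC k (Nat.lt_succ_self k), Bst_eq_true_iff]
    rw [key]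

/-! ### Decoding the input length -/

/-- The stage of an input length of the form `m = P(n) + k`, `k < n` (a bounded search; capped by `m`).
[cite: ChenEtAl2022, §5.1 (proof of Lemma 6: B^{(i)} on input 1^{ℓ^{(i)}(n)})] -/
def decM (m : ℕ) : ℕ :=
  min ((List.range (m + 1)).findIdx fun j => decide ((D.P R₁ R₂).eval j ≤ m ∧ m < (D.P R₁ R₂).eval j + j)) m

/-- The stage of an input length `m = ℓ₁(n)`. [cite: ChenEtAl2022, §5.1 (proof of Lemma 6)] -/
def decJ (m : ℕ) : ℕ :=
  min ((List.range (m + 1)).findIdx fun j => decide ((D.S.ℓ₁ R₁).eval j = m)) m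

/-- `decM (P(n) + k) = n` for `k < n`. [cite: ChenEtAl2022, §5.1 (proof of Lemma 6)] -/
theorem decM_spec {n k : ℕ} (hk : k < n) : D.decM R₁ R₂ ((D.P R₁ R₂).eval n + k) = n := by
  set m := (D.P R₁ R₂).eval n + k with hm
  have hnm : n ≤ m := (D.le_P R₁ R₂ n).trans (Nat.le_add_right _ _)
  have hfind : ((List.range (m + 1)).findIdx fun j => decide ((D.P R₁ R₂).eval j ≤ m ∧ m < (D.P R₁ R₂).eval j + j)) = n := by
    have hn : n < (List.range (m + 1)).length := by rw [List.length_range]; omega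
    rw [List.findIdx_eq hn]
    refine ⟨by simp [List.getElem_range]; omega, fun j hj => ?_⟩
    simp only [List.getElem_range, decide_eq_false_iff_not, not_and, not_lt]
    intro _
    have h1 : (D.P R₁ R₂).eval j + j < (D.P R₁ R₂).eval (j + 1) := D.P_add_lt R₁ R₂ j
    have h2 : (D.P R₁ R₂).eval (j + 1) ≤ (D.P R₁ R₂).eval n := (D.strictMono_P R₁ R₂).monotone hj
    omega
  rw [decM, hfind, min_eq_left hnm]

/-- `decJ (ℓ₁(n)) = n`. [cite: ChenEtAl2022, §5.1 (proof of Lemma 6)] -/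
theorem decJ_spec (n : ℕ) : D.decJ R₁ ((D.S.ℓ₁ R₁).eval n) = n := by
  set m := (D.S.ℓ₁ R₁).eval n with hm
  have hnm : n ≤ m := D.le_ℓ₁ R₁ n
  have hmono : StrictMono fun j => (D.S.ℓ₁ R₁).eval j := strictMono_eval_X_add _
  have hfind : ((List.range (m + 1)).findIdx fun j => decide ((D.S.ℓ₁ R₁).eval j = m)) = n := by
    have hn : n < (List.range (m + 1)).length := by rw [List.length_range]; omega
    rw [List.findIdx_eq hn]
    refine ⟨by simp [List.getElem_range, hm], fun j hj => ?_⟩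
    simp only [List.getElem_range, decide_eq_false_iff_not]
    exact fun h => absurd (hmono.injective (h.trans hm)) (Nat.ne_of_lt hj)
  rw [decJ, hfind, min_eq_left hnm]

/-! ### The candidate refuters as string functions -/

/-- The walk's current query at an input length `m` read as stage `n`: `zh n s r (m - P(n)) ∘ 0`. [folklore] -/
def wq (n : ℕ) (ω : List Bool) (m : ℕ) : List Bool :=
  D.zh R₁ R₂ n (D.sOf R₁ R₂ n ω) (D.rOf R₁ R₂ n ω) (m - (D.P R₁ R₂).eval n) ++ [false]

/-- The index of the first of the `n⁴` sample instances of the query `w` (at length `m`) answered `b`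
by the amplified decider (capped, so that it is always an index). [folklore] -/
def pick (n : ℕ) (ω : List Bool) (w : List Bool) (m : ℕ) (b : Bool) : ℕ :=
  min ((List.range (n ^ 4)).findIdx fun i =>
    D.amp (D.inst R₁ R₂ n (D.smp R₁ R₂ n ω i) w m) (D.sOf R₁ R₂ n ω) == b) (n ^ 4 - 1)

/-- **Candidate `M_b`** on `1ᵐ`, `m = P(n) + k`: walk `k` steps, then among the `n⁴` sample instances of
the current query `z_k 0` (at length `m`) print the first one the amplified decider answers `b`
(a default sample if there is none). [cite: ChenEtAl2022, §5.1 (Algorithm 1; Lemma 6) and §5.2 (proof of Thm. 5)] -/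
def outM (b : Bool) (m : ℕ) (ω : List Bool) : List Bool :=
  D.inst R₁ R₂ (D.decM R₁ R₂ m)
    (D.smp R₁ R₂ (D.decM R₁ R₂ m) ω
      (D.pick R₁ R₂ (D.decM R₁ R₂ m) ω (D.wq R₁ R₂ (D.decM R₁ R₂ m) ω m) m b))
    (D.wq R₁ R₂ (D.decM R₁ R₂ m) ω m) m

/-- **Candidate `T_y`** on `1ⁿ`: the end point of the walk. [cite: ChenEtAl2022, §5.2 (proof of Thm. 5, the string p_n(x*) of the list)] -/
def outY (m : ℕ) (ω : List Bool) : List Bool :=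
  D.zh R₁ R₂ m (D.sOf R₁ R₂ m ω) (D.rOf R₁ R₂ m ω) m

/-- **Candidate `T_j`** on `1^{ℓ₁(n)}`: the `j`-th level-1 probe instance at the end point of the walk,
the witness search being driven by the amplified decider. [cite: ChenEtAl2022, §5.2 (proof of Thm. 5, the queries of R^A(y,…), R^A(y∘0,…), R^A(y∘1,…))] -/
def outJ (j : ℕ) (m : ℕ) (ω : List Bool) : List Bool :=
  D.probeInst R₁ (fun x => D.amp x (D.sOf R₁ R₂ (D.decJ R₁ m) ω))
    (D.zh R₁ R₂ (D.decJ R₁ m) (D.sOf R₁ R₂ (D.decJ R₁ m) ω) (D.rOf R₁ R₂ (D.decJ R₁ m) ω) (D.decJ R₁ m)) j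

/-! ### Behaviour on good coins -/

/-- `P(n) + k ≤ Bnd(n)` for `k ≤ n`. [folklore] -/
theorem P_add_le_Bnd {n k : ℕ} (hk : k ≤ n) : (D.P R₁ R₂).eval n + k ≤ (D.Bnd R₁ R₂).eval n := by
  rw [Bnd_eval]; omega

/-- `ℓ₁(n) ≤ Bnd(n)`. [folklore] -/
theorem ℓ₁_le_Bnd (n : ℕ) : (D.S.ℓ₁ R₁).eval n ≤ (D.Bnd R₁ R₂).eval n := by
  rw [Bnd_eval]; omega

/-- **`M_b` harvests a counterexample.** At `m = P(n) + k`, `k < n`: if the evaluation block is good for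
`n … Bnd(n)`, the instance block is short and `L''` is right on its canonical instances below depth `k`,
every sample block is good for `n … ℓ₁(n)`, some sample instance of the canonical query `zst k ∘ 0` is
answered `b` by `L''`, and `b` is the WRONG answer (`b ↔ ¬ T n (zst k ∘ 0)`), then the printed string has
length `m` and lies in `L ∆ L''`. [cite: ChenEtAl2022, §5.2 (proof of Thm. 5: "the query made to A … is a counterexample")] -/
theorem outM_err (hS : D.Spec) {n k : ℕ} (hk : k < n) {ω : List Bool}
    (hs : D.CoinGood n ((D.Bnd R₁ R₂).eval n) (D.sOf R₁ R₂ n ω))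
    (hRC : D.RC R₁ R₂ n (D.rOf R₁ R₂ n ω) k)
    (hsmp : ∀ i, i < n ^ 4 → D.CoinGood n ((D.S.ℓ₁ R₁).eval n) (D.smp R₁ R₂ n ω i))
    {b : Bool} (hb : (b = true ↔ ¬ D.T R₁ n (D.zst R₁ n k ++ [false])))
    (hex : ∃ i, i < n ^ 4 ∧ (D.inst R₁ R₂ n (D.smp R₁ R₂ n ω i) (D.zst R₁ n k ++ [false]) ((D.P R₁ R₂).eval n + k) ∈ D.L'' ↔ b = true)) :
    (D.outM R₁ R₂ b ((D.P R₁ R₂).eval n + k) ω).length = (D.P R₁ R₂).eval n + k ∧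
      (D.outM R₁ R₂ b ((D.P R₁ R₂).eval n + k) ω ∈ D.L ↔ D.outM R₁ R₂ b ((D.P R₁ R₂).eval n + k) ω ∉ D.L'') := by
  set m := (D.P R₁ R₂).eval n + k with hm
  have hn : D.decM R₁ R₂ m = n := D.decM_spec R₁ R₂ hk
  have hkm : m - (D.P R₁ R₂).eval n = k := by rw [hm]; omega
  have hPm : (D.P R₁ R₂).eval n ≤ m := Nat.le_add_right _ _
  have hmB : m ≤ (D.Bnd R₁ R₂).eval n := D.P_add_le_Bnd R₁ R₂ hk.le
  have hz : D.zh R₁ R₂ n (D.sOf R₁ R₂ n ω) (D.rOf R₁ R₂ n ω) k = D.zst R₁ n k :=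
    D.zh_eq_zst R₁ R₂ hS hs (D.length_rOf_le R₁ R₂ n ω) hk.le hRC
  set w := D.zst R₁ n k ++ [false] with hw
  have hwlen : w.length ≤ n + 1 := by rw [hw, List.length_append, length_zst]; simp; omega
  -- the sample instances: length, exact answer, canonical question
  have hI : ∀ i, i < n ^ 4 →
      (D.inst R₁ R₂ n (D.smp R₁ R₂ n ω i) w m).length = m ∧
      (D.amp (D.inst R₁ R₂ n (D.smp R₁ R₂ n ω i) w m) (D.sOf R₁ R₂ n ω) = true ↔
        D.inst R₁ R₂ n (D.smp R₁ R₂ n ω i) w m ∈ D.L'') ∧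
      (D.inst R₁ R₂ n (D.smp R₁ R₂ n ω i) w m ∈ D.L ↔ D.T R₁ n w) := by
    intro i hi
    have hl := D.length_inst R₁ R₂ hS (D.length_smp_le R₁ R₂ n ω i) hwlen hPm
    exact ⟨hl, hs _ (by rw [hl]; exact (D.le_P R₁ R₂ n).trans hPm) (by rw [hl]; exact hmB),
      D.inst_mem_iff_T R₁ R₂ hS (hsmp i hi) (D.length_smp_le R₁ R₂ n ω i) hwlen hPm⟩
  -- the first sample answered `b`
  set p : ℕ → Bool := fun i => D.amp (D.inst R₁ R₂ n (D.smp R₁ R₂ n ω i) w m) (D.sOf R₁ R₂ n ω) == b with hp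
  set i₀ := (List.range (n ^ 4)).findIdx p with hi₀
  have hex' : ∃ i ∈ List.range (n ^ 4), p i = true := by
    obtain ⟨i, hi, hib⟩ := hex
    refine ⟨i, List.mem_range.2 hi, ?_⟩
    simp only [hp, beq_iff_eq]
    rw [Bool.eq_iff_iff, (hI i hi).2.1, hib]
  have hi₀lt : i₀ < n ^ 4 := by
    have := List.findIdx_lt_length_of_exists hex'
    rwa [List.length_range] at this
  have hpi₀ : p i₀ = true := by
    have h := List.findIdx_getElem (p := p) (xs := List.range (n ^ 4)) (w := by rwa [List.length_range])
    rwa [List.getElem_range] at h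
  have hmin : min i₀ (n ^ 4 - 1) = i₀ := min_eq_left (by omega)
  -- unfold the output
  have hwq : D.wq R₁ R₂ n ω m = w := by rw [wq, hkm, hz]
  have hpick : D.pick R₁ R₂ n ω w m b = i₀ := by rw [pick, ← hp, ← hi₀, hmin]
  have hout : D.outM R₁ R₂ b m ω = D.inst R₁ R₂ n (D.smp R₁ R₂ n ω i₀) w m := by
    rw [outM, hn, hwq, hpick]
  rw [hout]
  obtain ⟨hl, hamp, hT⟩ := hI i₀ hi₀lt
  refine ⟨hl, ?_⟩
  simp only [hp, beq_iff_eq] at hpi₀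
  rw [hT, ← hamp, hpi₀, hb, not_not]

/-- **`T_y` prints the canonical bad string** on good coins. [cite: ChenEtAl2022, §5.2 (proof of Thm. 5)] -/
theorem outY_eq (hS : D.Spec) {n : ℕ} {ω : List Bool} (hs : D.CoinGood n ((D.Bnd R₁ R₂).eval n) (D.sOf R₁ R₂ n ω))
    (hRC : D.RC R₁ R₂ n (D.rOf R₁ R₂ n ω) n) : D.outY R₁ R₂ n ω = D.yst R₁ n :=
  D.zh_eq_zst R₁ R₂ hS hs (D.length_rOf_le R₁ R₂ n ω) le_rfl hRC

/-- **`T_j` prints the canonical level-1 probe instance** on good coins. [cite: ChenEtAl2022, §5.2 (proof of Thm. 5)] -/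
theorem outJ_eq (hS : D.Spec) {n : ℕ} {ω : List Bool} (hs : D.CoinGood n ((D.Bnd R₁ R₂).eval n) (D.sOf R₁ R₂ n ω))
    (hRC : D.RC R₁ R₂ n (D.rOf R₁ R₂ n ω) n) (j : ℕ) :
    D.outJ R₁ R₂ j ((D.S.ℓ₁ R₁).eval n) ω = D.probeInst R₁ D.aT (D.yst R₁ n) j := by
  rw [outJ, decJ_spec, D.zh_eq_zst R₁ R₂ hS hs (D.length_rOf_le R₁ R₂ n ω) le_rfl hRC]
  exact D.probeInst_amp_eq R₁ hS (hs.mono le_rfl (D.ℓ₁_le_Bnd R₁ R₂ n)) (D.length_yst R₁ n) j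

/-! ### The candidates are polynomial time -/

section CodeFPMembers

/-- Unary truncated subtraction on codes. [folklore] -/
theorem codeFP_unSub : CodeFP (pairE unE unE) unE fun p => p.1 - p.2 :=
  (unOfNatMin.comp ((fst _ _).pair (natSub.comp ((natOfUn.comp (fst _ _)).pair (natOfUn.comp (snd _ _)))))).congr
    fun _ => min_eq_left (Nat.sub_le _ _)

/-- `n ↦ n⁴` in unary. [folklore] -/
theorem codeFP_unPow4 : CodeFP unE unE fun n => n ^ 4 :=
  ((ulength unitE).comp (unitsPow 4)).congr fun n => by simp

variable {D R₁ R₂}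

/-- The evaluation block is polynomial time. [cite: AroraBarak2009, §1.3] -/
theorem codeFP_sOf : CodeFP (pairE unE strE) strE fun t => D.sOf R₁ R₂ t.1 t.2 :=
  (strTake.comp (((codeFP_unPoly (D.βs R₁ R₂)).comp (fst _ _)).pair (snd _ _))).congr fun _ => rfl

/-- The instance block is polynomial time. [cite: AroraBarak2009, §1.3] -/
theorem codeFP_rOf : CodeFP (pairE unE strE) strE fun t => D.rOf R₁ R₂ t.1 t.2 := by
  have hd : CodeFP (pairE unE strE) strE (fun t => t.2.drop ((D.βs R₁ R₂).eval t.1)) :=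
    strDrop.comp (((codeFP_unPoly (D.βs R₁ R₂)).comp (fst _ _)).pair (snd _ _))
  exact (strTake.comp (((codeFP_unPoly (D.βr R₁)).comp (fst _ _)).pair hd)).congr fun _ => rfl

/-- The sample blocks are polynomial time (index in binary). [cite: AroraBarak2009, §1.3] -/
theorem codeFP_smp : CodeFP (pairE (pairE unE strE) natE) strE fun t => D.smp R₁ R₂ t.1.1 t.1.2 t.2 := by
  have hn : CodeFP (pairE (pairE unE strE) natE) unE (fun t => t.1.1) := (fst _ _).fst'
  have hβr : CodeFP (pairE (pairE unE strE) natE) unE (fun t => (D.βr R₁).eval t.1.1) := (codeFP_unPoly _).comp hn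
  have hoff : CodeFP (pairE (pairE unE strE) natE) unE (fun t => (D.βs R₁ R₂).eval t.1.1 + (D.βr R₁).eval t.1.1) :=
    unAdd.comp (((codeFP_unPoly _).comp hn).pair hβr)
  have hω' : CodeFP (pairE (pairE unE strE) natE) strE (fun t => t.1.2.drop ((D.βs R₁ R₂).eval t.1.1 + (D.βr R₁).eval t.1.1)) :=
    strDrop.comp (hoff.pair (fst _ _).snd')
  have hprod : CodeFP (pairE (pairE unE strE) natE) natE (fun t => t.2 * (D.βr R₁).eval t.1.1) :=
    natMul.comp ((snd _ _).pair (natOfUn.comp hβr))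
  have hcnt : CodeFP (pairE (pairE unE strE) natE) unE
      (fun t => min (t.2 * (D.βr R₁).eval t.1.1) (t.1.2.drop ((D.βs R₁ R₂).eval t.1.1 + (D.βr R₁).eval t.1.1)).length) :=
    unOfNatMin.comp ((strLength.comp hω').pair hprod)
  have hd : CodeFP (pairE (pairE unE strE) natE) strE
      (fun t => (t.1.2.drop ((D.βs R₁ R₂).eval t.1.1 + (D.βr R₁).eval t.1.1)).drop
        (min (t.2 * (D.βr R₁).eval t.1.1) (t.1.2.drop ((D.βs R₁ R₂).eval t.1.1 + (D.βr R₁).eval t.1.1)).length)) :=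
    strDrop.comp (hcnt.pair hω')
  refine (strTake.comp (hβr.pair hd)).congr fun t => ?_
  -- dropping a capped count is dropping the count
  have hdrop : ∀ (l : List Bool) (c : ℕ), l.drop (min c l.length) = l.drop c := fun l c => by
    by_cases h : c ≤ l.length
    · rw [min_eq_left h]
    · push Not at h
      rw [min_eq_right h.le, List.drop_length, List.drop_eq_nil_of_le h.le]
  simp only [hdrop]; rfl

/-- The walk's oracle bit is polynomial time in `(n, s, r)` and the query. [cite: AroraBarak2009, §1.3] -/
theorem codeFP_wB (hC : D.Codes) :
    CodeFP (pairE (pairE unE (pairE strE strE)) strE) bitE fun t => D.wB R₁ R₂ t.1.1 t.1.2.1 t.1.2.2 t.2 := by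
  have hn : CodeFP (pairE (pairE unE (pairE strE strE)) strE) unE (fun t => t.1.1) := (fst _ _).fst'
  have hs : CodeFP (pairE (pairE unE (pairE strE strE)) strE) strE (fun t => t.1.2.1) := (fst _ _).snd'.fst'
  have hr : CodeFP (pairE (pairE unE (pairE strE strE)) strE) strE (fun t => t.1.2.2) := (fst _ _).snd'.snd'
  have hw : CodeFP (pairE (pairE unE (pairE strE strE)) strE) strE (fun t => t.2) := snd _ _
  have hlen : CodeFP (pairE (pairE unE (pairE strE strE)) strE) unE (fun t => t.2.length) := strLength.comp hw
  have hpred : CodeFP (pairE (pairE unE (pairE strE strE)) strE) unE (fun t => t.2.length - 1) :=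
    codeFP_unSub.comp (hlen.pair (const _ 1))
  have hm : CodeFP (pairE (pairE unE (pairE strE strE)) strE) unE (fun t => (D.P R₁ R₂).eval t.1.1 + (t.2.length - 1)) :=
    unAdd.comp (((codeFP_unPoly _).comp hn).pair hpred)
  have hi := (D.codeFP_inst R₁ R₂ hC).comp ((hn.pair hr).pair (hw.pair hm))
  have hi' : CodeFP (pairE (pairE unE (pairE strE strE)) strE) strE
      (fun t => D.inst R₁ R₂ t.1.1 t.1.2.2 t.2 ((D.P R₁ R₂).eval t.1.1 + (t.2.length - 1))) := hi.congr fun _ => rfl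
  exact ((D.codeFP_amp hC).comp (hi'.pair hs)).congr fun _ => rfl

/-- The walk is polynomial time in `(n, s, r)` and the number of rounds. [cite: AroraBarak2009, §1.3 (polynomially bounded loops)] -/
theorem codeFP_zh (hC : D.Codes) :
    CodeFP (pairE (pairE unE (pairE strE strE)) unE) strE fun t => D.zh R₁ R₂ t.1.1 t.1.2.1 t.1.2.2 t.2 := by
  have hB := (codeFP_wB (D := D) (R₁ := R₁) (R₂ := R₂) hC).comp
    ((fst (pairE (pairE unE (pairE strE strE)) unE) strE).fst'.pair (snd (pairE (pairE unE (pairE strE strE)) unE) strE))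
  have hB' : CodeFP (pairE (pairE (pairE unE (pairE strE strE)) unE) strE) bitE
      (fun q => D.wB R₁ R₂ q.1.1.1 q.1.1.2.1 q.1.1.2.2 q.2) := hB.congr fun _ => rfl
  have hz := codeFP_searchZ (σ := (ℕ × (List Bool × List Bool)) × ℕ) (eσ := pairE (pairE unE (pairE strE strE)) unE)
    (Bf := fun c w => D.wB R₁ R₂ c.1.1 c.1.2.1 c.1.2.2 w) (m := Prod.snd) hB' (snd _ _)
  exact hz.congr fun _ => rfl

/-- The walk from the coin string: `(n, ω, k) ↦ zh n (sOf n ω) (rOf n ω) k`. [cite: AroraBarak2009, §1.3] -/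
theorem codeFP_zhω (hC : D.Codes) :
    CodeFP (pairE (pairE unE strE) unE) strE fun t => D.zh R₁ R₂ t.1.1 (D.sOf R₁ R₂ t.1.1 t.1.2) (D.rOf R₁ R₂ t.1.1 t.1.2) t.2 := by
  have hctx : CodeFP (pairE (pairE unE strE) unE) (pairE unE (pairE strE strE))
      (fun t => (t.1.1, (D.sOf R₁ R₂ t.1.1 t.1.2, D.rOf R₁ R₂ t.1.1 t.1.2))) :=
    (fst _ _).fst'.pair ((codeFP_sOf.comp (fst _ _)).pair (codeFP_rOf.comp (fst _ _)))
  exact ((codeFP_zh hC).comp (hctx.pair (snd _ _))).congr fun _ => rfl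

/-- `findIdx` only depends on the predicate on the list's members. [folklore] -/
theorem findIdx_congr_mem {α : Type} {p q : α → Bool} : ∀ {l : List α}, (∀ a ∈ l, p a = q a) → l.findIdx p = l.findIdx q
  | [], _ => rfl
  | a :: l, h => by
    rw [List.findIdx_cons, List.findIdx_cons, h a (by simp),
      findIdx_congr_mem (l := l) fun b hb => h b (List.mem_cons_of_mem a hb)]

/-- `decide (a ∧ b) = (decide a && decide b)`. [folklore] -/
theorem decide_and_eq (a b : Prop) [Decidable a] [Decidable b] : decide (a ∧ b) = (decide a && decide b) := by
  by_cases ha : a <;> by_cases hb : b <;> simp [ha, hb]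

/-- The stage decoder `decM` is polynomial time. [cite: ChenEtAl2022, §5.1 (proof of Lemma 6)] -/
theorem codeFP_decM : CodeFP unE unE (D.decM R₁ R₂) := by
  -- predicate on (m, j): `P j ≤ m ∧ m < P j + j`, with `j` (binary, `≤ m`) converted to unary
  have hm : CodeFP (pairE unE natE) unE (fun t => t.1) := fst _ _
  have hj : CodeFP (pairE unE natE) unE (fun t => min t.2 t.1) := unOfNatMin
  have hP : CodeFP (pairE unE natE) unE (fun t => (D.P R₁ R₂).eval (min t.2 t.1)) := (codeFP_unPoly _).comp hj
  have t1 : CodeFP (pairE unE natE) bitE (fun t => decide ((D.P R₁ R₂).eval (min t.2 t.1) ≤ t.1)) :=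
    natLeUn.comp ((natOfUn.comp hP).pair hm)
  have t2 : CodeFP (pairE unE natE) bitE (fun t => decide (t.1 < (D.P R₁ R₂).eval (min t.2 t.1) + min t.2 t.1)) :=
    natLt.comp ((natOfUn.comp hm).pair (natOfUn.comp (unAdd.comp (hP.pair hj))))
  have hpred : CodeFP (pairE unE natE) bitE
      (fun t => decide ((D.P R₁ R₂).eval (min t.2 t.1) ≤ t.1 ∧ t.1 < (D.P R₁ R₂).eval (min t.2 t.1) + min t.2 t.1)) :=
    (t1.and t2).congr fun t => (decide_and_eq _ _).symm
  have hfind := (findIdxFP hpred).comp ((CodeFP.id unE).pair (urange.comp unSucc))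
  have hfind' : CodeFP unE natE
      (fun m => (List.range (m + 1)).findIdx fun j => decide ((D.P R₁ R₂).eval j ≤ m ∧ m < (D.P R₁ R₂).eval j + j)) := by
    refine hfind.congr fun m => ?_
    change (List.range (m + 1)).findIdx (fun j => decide ((D.P R₁ R₂).eval (min j m) ≤ m ∧ m < (D.P R₁ R₂).eval (min j m) + min j m)) = _
    refine findIdx_congr_mem ?_
    intro j hj
    rw [min_eq_left (Nat.le_of_lt_succ (List.mem_range.1 hj))]
  exact (unOfNatMin.comp ((CodeFP.id unE).pair hfind')).congr fun _ => rfl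

/-- The stage decoder `decJ` is polynomial time. [cite: ChenEtAl2022, §5.1 (proof of Lemma 6)] -/
theorem codeFP_decJ : CodeFP unE unE (D.decJ R₁) := by
  have hm : CodeFP (pairE unE natE) unE (fun t => t.1) := fst _ _
  have hj : CodeFP (pairE unE natE) unE (fun t => min t.2 t.1) := unOfNatMin
  have hpred : CodeFP (pairE unE natE) bitE (fun t => decide ((D.S.ℓ₁ R₁).eval (min t.2 t.1) = t.1)) :=
    (CodeFP.eq unE_injective).comp (((codeFP_unPoly _).comp hj).pair hm)
  have hfind := (findIdxFP hpred).comp ((CodeFP.id unE).pair (urange.comp unSucc))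
  have hfind' : CodeFP unE natE (fun m => (List.range (m + 1)).findIdx fun j => decide ((D.S.ℓ₁ R₁).eval j = m)) := by
    refine hfind.congr fun m => ?_
    change (List.range (m + 1)).findIdx (fun j => decide ((D.S.ℓ₁ R₁).eval (min j m) = m)) = _
    refine findIdx_congr_mem ?_
    intro j hj
    rw [min_eq_left (Nat.le_of_lt_succ (List.mem_range.1 hj))]
  exact (unOfNatMin.comp ((CodeFP.id unE).pair hfind')).congr fun _ => rfl

/-- The current query is polynomial time in `(n, ω, m)`. [cite: AroraBarak2009, §1.3] -/
theorem codeFP_wq (hC : D.Codes) : CodeFP (pairE (pairE unE strE) unE) strE fun t => D.wq R₁ R₂ t.1.1 t.1.2 t.2 := by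
  have hk : CodeFP (pairE (pairE unE strE) unE) unE (fun t => t.2 - (D.P R₁ R₂).eval t.1.1) :=
    codeFP_unSub.comp ((snd _ _).pair ((codeFP_unPoly _).comp (fst _ _).fst'))
  have hz := (codeFP_zhω (D := D) (R₁ := R₁) (R₂ := R₂) hC).comp ((fst _ _).pair hk)
  have hz' : CodeFP (pairE (pairE unE strE) unE) strE
      (fun t => D.zh R₁ R₂ t.1.1 (D.sOf R₁ R₂ t.1.1 t.1.2) (D.rOf R₁ R₂ t.1.1 t.1.2) (t.2 - (D.P R₁ R₂).eval t.1.1)) :=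
    hz.congr fun _ => rfl
  exact (strAppend.comp (hz'.pair (const _ [false]))).congr fun _ => rfl

/-- The sample index is polynomial time in `((n, ω), (w, m))` (for a fixed answer `b`). [cite: AroraBarak2009, §1.3] -/
theorem codeFP_pick (hC : D.Codes) (b : Bool) :
    CodeFP (pairE (pairE unE strE) (pairE strE unE)) natE fun t => D.pick R₁ R₂ t.1.1 t.1.2 t.2.1 t.2.2 b := by
  -- the predicate on (ctx, i)
  have hc : CodeFP (pairE (pairE (pairE unE strE) (pairE strE unE)) natE) (pairE unE strE) (fun q => q.1.1) := (fst _ _).fst'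
  have hsmp' := (codeFP_smp (D := D) (R₁ := R₁) (R₂ := R₂)).comp (hc.pair (snd _ _))
  have hsmp : CodeFP (pairE (pairE (pairE unE strE) (pairE strE unE)) natE) strE
      (fun q => D.smp R₁ R₂ q.1.1.1 q.1.1.2 q.2) := hsmp'.congr fun _ => rfl
  have hinst' := (D.codeFP_inst R₁ R₂ hC).comp (((hc.fst').pair hsmp).pair (fst _ _).snd')
  have hinst : CodeFP (pairE (pairE (pairE unE strE) (pairE strE unE)) natE) strE
      (fun q => D.inst R₁ R₂ q.1.1.1 (D.smp R₁ R₂ q.1.1.1 q.1.1.2 q.2) q.1.2.1 q.1.2.2) := hinst'.congr fun _ => rfl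
  have hsOf' := (codeFP_sOf (D := D) (R₁ := R₁) (R₂ := R₂)).comp hc
  have hsOf : CodeFP (pairE (pairE (pairE unE strE) (pairE strE unE)) natE) strE
      (fun q => D.sOf R₁ R₂ q.1.1.1 q.1.1.2) := hsOf'.congr fun _ => rfl
  have hamp' := (D.codeFP_amp hC).comp (hinst.pair hsOf)
  have hamp : CodeFP (pairE (pairE (pairE unE strE) (pairE strE unE)) natE) bitE
      (fun q => D.amp (D.inst R₁ R₂ q.1.1.1 (D.smp R₁ R₂ q.1.1.1 q.1.1.2 q.2) q.1.2.1 q.1.2.2) (D.sOf R₁ R₂ q.1.1.1 q.1.1.2)) :=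
    hamp'.congr fun _ => rfl
  have hpred : CodeFP (pairE (pairE (pairE unE strE) (pairE strE unE)) natE) bitE
      (fun q => D.amp (D.inst R₁ R₂ q.1.1.1 (D.smp R₁ R₂ q.1.1.1 q.1.1.2 q.2) q.1.2.1 q.1.2.2) (D.sOf R₁ R₂ q.1.1.1 q.1.1.2) == b) :=
    (beq bitE_injective).comp (hamp.pair (const _ b))
  have hn4 : CodeFP (pairE (pairE unE strE) (pairE strE unE)) unE (fun t => t.1.1 ^ 4) := codeFP_unPow4.comp (fst _ _).fst'
  have hfind' := (findIdxFP hpred).comp ((CodeFP.id _).pair (urange.comp hn4))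
  have hfind : CodeFP (pairE (pairE unE strE) (pairE strE unE)) natE
      (fun t => (List.range (t.1.1 ^ 4)).findIdx fun i =>
        D.amp (D.inst R₁ R₂ t.1.1 (D.smp R₁ R₂ t.1.1 t.1.2 i) t.2.1 t.2.2) (D.sOf R₁ R₂ t.1.1 t.1.2) == b) :=
    hfind'.congr fun _ => rfl
  have hcap : CodeFP (pairE (pairE unE strE) (pairE strE unE)) natE (fun t => t.1.1 ^ 4 - 1) :=
    natSub.comp ((natOfUn.comp hn4).pair (const _ 1))
  exact (natMin.comp (hfind.pair hcap)).congr fun _ => rfl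

/-- **Candidate `M_b` is polynomial time.** [cite: ChenEtAl2022, §5.1 (proof of Lemma 6: B^{(i)} runs in poly(n) ≤ poly(ℓ^{(i)}(n)) time)] -/
theorem codeFP_outM (hC : D.Codes) (b : Bool) : CodeFP (pairE unE strE) strE fun t => D.outM R₁ R₂ b t.1 t.2 := by
  have hn : CodeFP (pairE unE strE) unE (fun t => D.decM R₁ R₂ t.1) := codeFP_decM.comp (fst _ _)
  have hctx : CodeFP (pairE unE strE) (pairE unE strE) (fun t => (D.decM R₁ R₂ t.1, t.2)) := hn.pair (snd _ _)
  have hwq' := (codeFP_wq (D := D) (R₁ := R₁) (R₂ := R₂) hC).comp (hctx.pair (fst _ _))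
  have hwq : CodeFP (pairE unE strE) strE (fun t => D.wq R₁ R₂ (D.decM R₁ R₂ t.1) t.2 t.1) := hwq'.congr fun _ => rfl
  have hpk' := (codeFP_pick (D := D) (R₁ := R₁) (R₂ := R₂) hC b).comp (hctx.pair (hwq.pair (fst _ _)))
  have hpk : CodeFP (pairE unE strE) natE
      (fun t => D.pick R₁ R₂ (D.decM R₁ R₂ t.1) t.2 (D.wq R₁ R₂ (D.decM R₁ R₂ t.1) t.2 t.1) t.1 b) := hpk'.congr fun _ => rfl
  have hsm' := (codeFP_smp (D := D) (R₁ := R₁) (R₂ := R₂)).comp (hctx.pair hpk)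
  have hsm : CodeFP (pairE unE strE) strE
      (fun t => D.smp R₁ R₂ (D.decM R₁ R₂ t.1) t.2 (D.pick R₁ R₂ (D.decM R₁ R₂ t.1) t.2 (D.wq R₁ R₂ (D.decM R₁ R₂ t.1) t.2 t.1) t.1 b)) :=
    hsm'.congr fun _ => rfl
  have hi' := (D.codeFP_inst R₁ R₂ hC).comp ((hn.pair hsm).pair (hwq.pair (fst _ _)))
  exact hi'.congr fun _ => rfl

/-- **Candidate `T_y` is polynomial time.** [cite: ChenEtAl2022, §5.2 (proof of Thm. 5)] -/
theorem codeFP_outY (hC : D.Codes) : CodeFP (pairE unE strE) strE fun t => D.outY R₁ R₂ t.1 t.2 :=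
  ((codeFP_zhω hC).comp ((CodeFP.id _).pair (fst _ _))).congr fun _ => rfl

/-- **Candidate `T_j` is polynomial time.** [cite: ChenEtAl2022, §5.2 (proof of Thm. 5)] -/
theorem codeFP_outJ (hC : D.Codes) (j : ℕ) : CodeFP (pairE unE strE) strE fun t => D.outJ R₁ R₂ j t.1 t.2 := by
  have hn : CodeFP (pairE unE strE) unE (fun t => D.decJ R₁ t.1) := codeFP_decJ.comp (fst _ _)
  have hctx : CodeFP (pairE unE strE) (pairE unE strE) (fun t => (D.decJ R₁ t.1, t.2)) := hn.pair (snd _ _)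
  have hy' := (codeFP_zhω (D := D) (R₁ := R₁) (R₂ := R₂) hC).comp (hctx.pair hn)
  have hy : CodeFP (pairE unE strE) strE
      (fun t => D.zh R₁ R₂ (D.decJ R₁ t.1) (D.sOf R₁ R₂ (D.decJ R₁ t.1) t.2) (D.rOf R₁ R₂ (D.decJ R₁ t.1) t.2) (D.decJ R₁ t.1)) :=
    hy'.congr fun _ => rfl
  have hs' := (codeFP_sOf (D := D) (R₁ := R₁) (R₂ := R₂)).comp hctx
  have hs : CodeFP (pairE unE strE) strE (fun t => D.sOf R₁ R₂ (D.decJ R₁ t.1) t.2) := hs'.congr fun _ => rfl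
  have ha : CodeFP (pairE strE strE) bitE (fun t => D.amp t.2 t.1) := (D.codeFP_amp hC).comp ((snd _ _).pair (fst _ _))
  have hpi := (D.codeFP_probeInst R₁ hC (af := fun c x => D.amp x c) ha j).comp (hs.pair hy)
  exact hpi.congr fun _ => rfl

end CodeFPMembers

end Data

end BPPNPRefuter

end Literature.Computability.MetaComplexity

end

/-!
## Part III: probabilities, the harvesting step, the endgame, and the theorem
-/

noncomputable section

namespace Literature.Computability.MetaComplexity

open _root_.Computability Complexity Filter Polynomial Brick CodeFP GSTRefuter Finset

namespace BPPNPRefuter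

/-! ### Gill machines on the unary input given by string functions -/

/-- **A candidate refuter presented by a string function**: on `1ᵐ` with coins `ω` it prints
`f ⟨1ᵐ, ω⟩`; coin budget exactly `c(m)`. [cite: ChenEtAl2022, Def. 1.1] -/
def unaryAlg (f : List Bool → List Bool) (c : Polynomial ℕ) : RandAlg ℕ (List Bool) where
  run m ω := f (boolPair (unaryEncodeNat m) ω)
  coinLen m := c.eval m

/-- `unaryAlg f c` is probabilistic polynomial time for `f ∈ FP` (its run map read through the pairing
IS `f`). [cite: ChenEtAl2022, Def. 1.1] -/
theorem unaryAlg_isPolyTime {f : List Bool → List Bool} (hf : f ∈ FP) (c : Polynomial ℕ) :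
    (unaryAlg f c).IsPolyTime unaryEncodeNat (id : List Bool → List Bool) := by
  refine ⟨?_, c, fun m => le_rfl⟩
  obtain ⟨P₀, M, hM⟩ := hf
  exact ⟨P₀, M, fun q => hM (boolPair (unaryEncodeNat q.1) q.2)⟩

/-- The success probability of `unaryAlg f c` is a counting probability over `{0,1}^{c(m)}`. [folklore] -/
theorem unaryAlg_pr (f : List Bool → List Bool) (c : Polynomial ℕ) (m : ℕ) (E : Set (List Bool)) :
    (unaryAlg f c).pr unaryEncodeNat m E = uniformProb (c.eval m) {ω | f (boolPair (unaryEncodeNat m) ω) ∈ E} := by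
  rw [RandAlg.pr_eq_uniformProb]
  simp only [unaryAlg]
  rw [show (unaryEncodeNat m).length = m from length_unE m]

/-- **Not a refuter, quantitatively.** If the candidate given by a string function computing
`F : ℕ → {0,1}* → {0,1}*` on codes is not a `BPP`-refuter for `L` against `L''`, then for all large
`n`, at every length `m ≥ n` it prints an `m`-bit string of `L ∆ L''` with probability `< 2/3`.
[cite: ChenEtAl2022, Def. 1.1] -/
theorem eventually_lt_of_not_refuter {L L'' : Language Bool} {F : ℕ → List Bool → List Bool}
    {f : List Bool → List Bool} (hf : f ∈ FP) (hfF : ∀ (m : ℕ) (ω : List Bool), f (boolPair (unaryEncodeNat m) ω) = F m ω)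
    (c : Polynomial ℕ) (h : ¬ IsBPPRefuter L L'' (unaryAlg f c)) :
    ∀ᶠ n in atTop, ∀ m, n ≤ m →
      uniformProb (c.eval m) {ω | (F m ω).length = m ∧ (F m ω ∈ L ↔ F m ω ∉ L'')} < 2 / 3 := by
  have h' : ¬ ∃ᶠ m in atTop, (2 : ℝ) / 3 ≤
      (unaryAlg f c).pr unaryEncodeNat m {x | x.length = m ∧ (x ∈ L ↔ x ∉ L'')} :=
    fun hfr => h ⟨unaryAlg_isPolyTime hf c, ⟨c, fun _ => rfl⟩, hfr⟩
  rw [Filter.not_frequently] at h'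
  obtain ⟨m₀, hm₀⟩ := Filter.eventually_atTop.1 h'
  refine Filter.eventually_atTop.2 ⟨m₀, fun n hn m hm => ?_⟩
  have h1 := hm₀ m (hn.trans hm)
  rw [not_le, unaryAlg_pr] at h1
  simpa only [hfF, Set.mem_setOf_eq] using h1

/-! ### Block probabilities of the coin string -/

namespace Data

variable (D : Data) (R₁ : Red D.S.H₁ D.L) (R₂ : Red (D.H₂ R₁) D.L)

/-- **The evaluation block is bad with probability `≤ 2·2⁻ⁿ`** (`n ≥ 2`, enough coins). [cite: ChenEtAl2022, §5.1 (proof of Thm. 4, case 𝒞 = BPP)] -/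
theorem uniformProb_sOf_bad_le (hS : D.Spec) {n M : ℕ} (hn : 2 ≤ n) (hM : (D.βs R₁ R₂).eval n ≤ M) :
    uniformProb M {ω | ¬ D.CoinGood n ((D.Bnd R₁ R₂).eval n) (D.sOf R₁ R₂ n ω)} ≤ 2 * (1 / 2) ^ n := by
  have hset : {ω : List Bool | ¬ D.CoinGood n ((D.Bnd R₁ R₂).eval n) (D.sOf R₁ R₂ n ω)} =
      {ω | ω.take ((D.βs R₁ R₂).eval n) ∈ {s : List Bool | ¬ D.CoinGood n ((D.Bnd R₁ R₂).eval n) s}} := rfl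
  rw [hset, uniformProb_take_of_le hM]
  exact D.uniformProb_not_coinGood_le hS hn (by simp [βs])

/-- An event read on the instance block has the block's probability. [cite: AroraBarak2009, §7.4.1] -/
theorem uniformProb_rOf_mem_le {n M : ℕ} (hM : (D.βs R₁ R₂).eval n + (D.βr R₁).eval n ≤ M) (B : Set (List Bool)) :
    uniformProb M {ω | D.rOf R₁ R₂ n ω ∈ B} ≤ uniformProb ((D.βr R₁).eval n) B := by
  obtain ⟨d, rfl⟩ := Nat.exists_eq_add_of_le hM
  exact uniformProb_block_le (fun _ => B) fun _ _ => le_rfl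

/-- The `i`-th sample block, as one block of the coin string. [folklore] -/
theorem smp_eq (n : ℕ) (ω : List Bool) (i : ℕ) :
    D.smp R₁ R₂ n ω i = (ω.drop ((D.βs R₁ R₂).eval n + (D.βr R₁).eval n + i * (D.βr R₁).eval n)).take ((D.βr R₁).eval n) := by
  rw [smp, List.drop_drop]

/-- An event read on a sample block has the block's probability. [cite: AroraBarak2009, §7.4.1] -/
theorem uniformProb_smp_mem_le {n M i : ℕ} (hM : (D.βs R₁ R₂).eval n + (D.βr R₁).eval n + (i + 1) * (D.βr R₁).eval n ≤ M)
    (B : Set (List Bool)) : uniformProb M {ω | D.smp R₁ R₂ n ω i ∈ B} ≤ uniformProb ((D.βr R₁).eval n) B := by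
  have hM' : (D.βs R₁ R₂).eval n + (D.βr R₁).eval n + i * (D.βr R₁).eval n + (D.βr R₁).eval n ≤ M := by
    rw [Nat.succ_mul] at hM; omega
  obtain ⟨d, rfl⟩ := Nat.exists_eq_add_of_le hM'
  simp only [smp_eq]
  exact uniformProb_block_le (fun _ => B) fun _ _ => le_rfl

/-- **The sample blocks are bad with probability `≤ N·2·2⁻ⁿ`.** [cite: AroraBarak2009, §7.4.1 (union bound)] -/
theorem uniformProb_smp_bad_le (hS : D.Spec) {n M N : ℕ} (hn : 2 ≤ n)
    (hM : (D.βs R₁ R₂).eval n + (D.βr R₁).eval n + N * (D.βr R₁).eval n ≤ M) :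
    uniformProb M {ω | ∃ i, i < N ∧ ¬ D.CoinGood n ((D.S.ℓ₁ R₁).eval n) (D.smp R₁ R₂ n ω i)} ≤ N * (2 * (1 / 2) ^ n) := by
  classical
  have hset : {ω : List Bool | ∃ i, i < N ∧ ¬ D.CoinGood n ((D.S.ℓ₁ R₁).eval n) (D.smp R₁ R₂ n ω i)} =
      ⋃ i ∈ Finset.range N, {ω | D.smp R₁ R₂ n ω i ∈ {c : List Bool | ¬ D.CoinGood n ((D.S.ℓ₁ R₁).eval n) c}} := by
    ext ω; simp
  rw [hset]
  refine (uniformProb_biUnion_le M _ _).trans ?_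
  calc ∑ i ∈ Finset.range N, uniformProb M {ω | D.smp R₁ R₂ n ω i ∈ {c : List Bool | ¬ D.CoinGood n ((D.S.ℓ₁ R₁).eval n) c}}
      ≤ ∑ _i ∈ Finset.range N, 2 * (1 / 2 : ℝ) ^ n := by
        refine Finset.sum_le_sum fun i hi => ?_
        have hi' : i < N := Finset.mem_range.1 hi
        refine (D.uniformProb_smp_mem_le R₁ R₂ (hM.trans' ?_) _).trans (D.uniformProb_not_coinGood_le hS hn (by simp [βr]))
        have : (i + 1) * (D.βr R₁).eval n ≤ N * (D.βr R₁).eval n := Nat.mul_le_mul_right _ hi'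
        omega
    _ = N * (2 * (1 / 2) ^ n) := by rw [Finset.sum_const, Finset.card_range, nsmul_eq_mul]

/-- **Consecutive independent blocks**: on `F` consecutive blocks of length `B`, the strings all of whose
blocks `i < F` lie in `OK i` number `∏ᵢ cnt B (OK i)`. [cite: AroraBarak2009, §7.4.1 (independent repetitions)] -/
theorem cnt_consecutiveBlocks (B : ℕ) (OK : ℕ → Set (List Bool)) : ∀ F : ℕ,
    cnt (F * B) {y | ∀ i, i < F → (y.drop (i * B)).take B ∈ OK i} = ∏ i ∈ Finset.range F, cnt B (OK i)
  | 0 => by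
    classical
    rw [Nat.zero_mul, cnt_zero, Finset.prod_range_zero]
    simp
  | F + 1 => by
    have ih := cnt_consecutiveBlocks B (fun i => OK (i + 1)) F
    rw [show (F + 1) * B = B + F * B by ring, Finset.prod_range_succ',
      mul_comm (∏ i ∈ Finset.range F, cnt B (OK (i + 1))) (cnt B (OK 0)), ← ih, ← cnt_take_drop]
    refine cnt_congr fun y _ => ?_
    simp only [Set.mem_setOf_eq]
    constructor
    · intro h
      refine ⟨by simpa using h 0 (Nat.succ_pos F), fun i hi => ?_⟩
      have := h (i + 1) (by omega)
      rwa [show (i + 1) * B = B + i * B by ring, ← List.drop_drop] at this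
    · rintro ⟨h0, h⟩ i hi
      rcases i with _ | i
      · simpa using h0
      · have := h i (by omega)
        rwa [show (i + 1) * B = B + i * B by ring, ← List.drop_drop]

/-- Reading blocks of a long enough prefix. [folklore] -/
theorem block_take (y : List Bool) {B N i : ℕ} (hi : i < N) :
    ((y.take (N * B)).drop (i * B)).take B = (y.drop (i * B)).take B := by
  rw [List.drop_take, List.take_take]
  congr 1
  have : (i + 1) * B ≤ N * B := Nat.mul_le_mul_right B hi
  rw [Nat.succ_mul] at this
  omega

/-- An event read after the first `a` coins has the probability of the remaining coins. [cite: AroraBarak2009, §7.4.1] -/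
theorem uniformProb_drop_eq (a n' : ℕ) (F : Set (List Bool)) :
    uniformProb (a + n') {ω | ω.drop a ∈ F} = uniformProb n' F := by
  have h := cnt_take_drop a n' Set.univ F
  rw [cnt_univ] at h
  have e : {y : List Bool | y.take a ∈ (Set.univ : Set (List Bool)) ∧ y.drop a ∈ F} = {ω | ω.drop a ∈ F} := by
    ext y; simp
  rw [e] at h
  rw [uniformProb_eq_cnt_div, uniformProb_eq_cnt_div, h, pow_add]
  push_cast
  rw [mul_div_mul_left _ _ (by positivity)]

/-- **Independent blocks all miss**: on coin strings `ω` of length `a + (N·B + d)`, the event that every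
block `(ω.drop a).block_i`, `i < N`, avoids `H` has probability `(1 - Pr_B[H])^N`.
[cite: AroraBarak2009, §7.4.1 (independent repetitions)] -/
theorem uniformProb_blocks_allMiss (a B N d : ℕ) (H : Set (List Bool)) :
    uniformProb (a + (N * B + d)) {ω | ∀ i, i < N → ((ω.drop a).drop (i * B)).take B ∉ H} = (1 - uniformProb B H) ^ N := by
  classical
  have h1 : {ω : List Bool | ∀ i, i < N → ((ω.drop a).drop (i * B)).take B ∉ H} =
      {ω | ω.drop a ∈ {y : List Bool | ∀ i, i < N → (y.drop (i * B)).take B ∉ H}} := rfl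
  have h2 : {y : List Bool | ∀ i, i < N → (y.drop (i * B)).take B ∉ H} =
      {y | y.take (N * B) ∈ {y' : List Bool | ∀ i, i < N → (y'.drop (i * B)).take B ∈ Hᶜ}} := by
    ext y
    simp only [Set.mem_setOf_eq, Set.mem_compl_iff]
    exact forall₂_congr fun i hi => by rw [block_take y hi]
  rw [h1, uniformProb_drop_eq, h2, uniformProb_take_of_le (Nat.le_add_right _ _), uniformProb_eq_cnt_div,
    cnt_consecutiveBlocks B (fun _ => Hᶜ) N, Finset.prod_const, Finset.card_range, ← uniformProb_compl, uniformProb_eq_cnt_div,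
    div_pow, ← pow_mul, mul_comm B N]
  push_cast
  ring

/-- **All sample blocks miss a set `H` with probability `(1 - Pr[H])^N`.** [cite: AroraBarak2009, §7.4.1 (independent repetitions)] -/
theorem uniformProb_smp_allMiss_le {n M N : ℕ} (hM : (D.βs R₁ R₂).eval n + (D.βr R₁).eval n + N * (D.βr R₁).eval n ≤ M)
    (H : Set (List Bool)) :
    uniformProb M {ω | ∀ i, i < N → D.smp R₁ R₂ n ω i ∉ H} ≤ (1 - uniformProb ((D.βr R₁).eval n) H) ^ N := by
  obtain ⟨d, rfl⟩ := Nat.exists_eq_add_of_le hM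
  rw [show (D.βs R₁ R₂).eval n + (D.βr R₁).eval n + N * (D.βr R₁).eval n + d =
      ((D.βs R₁ R₂).eval n + (D.βr R₁).eval n) + (N * (D.βr R₁).eval n + d) by ring]
  exact (uniformProb_blocks_allMiss _ _ N d H).le

/-- **Bernoulli**: `(1 - v)^N ≤ 1 / (1 + N v)` for `0 ≤ v ≤ 1`. (The same statement is proved as
`GabberGalil.one_sub_pow_le` in `Complexity/GabberGalil.lean`, which is not importable here without the
expander files it depends on.) [folklore] -/
theorem one_sub_pow_le {v : ℝ} (hv0 : 0 ≤ v) (hv1 : v ≤ 1) (N : ℕ) : (1 - v) ^ N ≤ 1 / (1 + N * v) := by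
  have hpos : 0 < 1 + (N : ℝ) * v := by positivity
  rw [le_div_iff₀ hpos]
  have h1 : (1 + (N : ℝ) * v) ≤ (1 + v) ^ N := one_add_mul_le_pow (by linarith) N
  have h2 : 0 ≤ (1 - v) ^ N := pow_nonneg (by linarith) N
  calc (1 - v) ^ N * (1 + N * v) ≤ (1 - v) ^ N * (1 + v) ^ N := mul_le_mul_of_nonneg_left h1 h2
    _ = (1 - v ^ 2) ^ N := by rw [← mul_pow]; ring_nf
    _ ≤ 1 := pow_le_one₀ (by nlinarith) (by nlinarith)

/-! ### The quantities of the induction -/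

/-- **The success event of a refuter at length `m`**: `m`-bit strings of `L ∆ L''`. [cite: ChenEtAl2022, Def. 1.1] -/
def Err (m : ℕ) : Set (List Bool) :=
  {x | x.length = m ∧ (x ∈ D.L ↔ x ∉ D.L'')}

/-- Membership in the success event. [folklore] -/
@[simp] theorem mem_Err (m : ℕ) (x : List Bool) : x ∈ D.Err m ↔ x.length = m ∧ (x ∈ D.L ↔ x ∉ D.L'') := Iff.rfl

/-- **The wrongly answered good seeds at depth `i`**: instance blocks good for `n … ℓ₁(n)` whose
canonical depth-`i` instance `L''` answers wrongly. [cite: ChenEtAl2022, §5.2 (proof of Thm. 5)] -/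
def Wr (n i : ℕ) : Set (List Bool) :=
  {r | D.CoinGood n ((D.S.ℓ₁ R₁).eval n) r ∧
    ¬ (D.inst R₁ R₂ n r (D.zst R₁ n i ++ [false]) ((D.P R₁ R₂).eval n + i) ∈ D.L'' ↔ D.T R₁ n (D.zst R₁ n i ++ [false]))}

/-- Their probability `u(n, i)`. [folklore] -/
def u (n i : ℕ) : ℝ :=
  uniformProb ((D.βr R₁).eval n) (D.Wr R₁ R₂ n i)

/-- **The coin budget of the candidates**: `βs + βr + m⁴·βr` coins on `1ᵐ`. [cite: ChenEtAl2022, Def. 1.1 (randomized polynomial time)] -/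
def coinPoly : Polynomial ℕ :=
  D.βs R₁ R₂ + D.βr R₁ + X ^ 4 * D.βr R₁

/-- The blocks of stage `n` fit into the coin budget of every length `m ≥ n`. [folklore] -/
theorem blocks_le_coinPoly {n m : ℕ} (h : n ≤ m) :
    (D.βs R₁ R₂).eval n + (D.βr R₁).eval n + n ^ 4 * (D.βr R₁).eval n ≤ (D.coinPoly R₁ R₂).eval m := by
  have h1 := TM2Iter.eval_mono (D.βs R₁ R₂) h
  have h2 := TM2Iter.eval_mono (D.βr R₁) h
  have h3 : n ^ 4 ≤ m ^ 4 := Nat.pow_le_pow_left h 4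
  simp only [coinPoly, eval_add, eval_mul, eval_pow, eval_X]
  have h4 : n ^ 4 * (D.βr R₁).eval n ≤ m ^ 4 * (D.βr R₁).eval m := Nat.mul_le_mul h3 h2
  omega

/-- Monotonicity of the counting probability. (Also `PromiseCook.uniformProb_mono` in
`Complexity/PromiseCookMachine.lean`, whose docstring already asks the librarian to hoist it into
`Randomized.lean`; not importable here without that file's Cook-reduction stack.) [folklore] -/
theorem uniformProb_mono_set {m : ℕ} {E E' : Set (List Bool)} (h : E ⊆ E') : uniformProb m E ≤ uniformProb m E' := by
  classical
  rw [uniformProb_eq_cnt_div, uniformProb_eq_cnt_div]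
  refine div_le_div_of_nonneg_right ?_ (by positivity)
  unfold cnt
  exact_mod_cast Finset.card_le_card fun r hr => by
    simp only [Finset.mem_filter, Finset.mem_univ, true_and] at hr ⊢; exact h hr

/-- **The walk fails to be canonical through depth `k` with probability `≤ 4·2⁻ⁿ + Σ_{i<k} u(n,i)`**
(bad evaluation block, bad instance block, or a wrongly answered canonical instance of a good block).
[cite: ChenEtAl2022, §5.2 (proof of Thm. 5); AroraBarak2009, §A.2 (union bound)] -/
theorem uniformProb_not_walkGood_le (hS : D.Spec) {n k M : ℕ} (hn : 2 ≤ n)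
    (hM : (D.βs R₁ R₂).eval n + (D.βr R₁).eval n ≤ M) :
    uniformProb M {ω | ¬ (D.CoinGood n ((D.Bnd R₁ R₂).eval n) (D.sOf R₁ R₂ n ω) ∧
      D.CoinGood n ((D.S.ℓ₁ R₁).eval n) (D.rOf R₁ R₂ n ω) ∧ D.RC R₁ R₂ n (D.rOf R₁ R₂ n ω) k)} ≤
      2 * (1 / 2) ^ n + 2 * (1 / 2) ^ n + ∑ i ∈ Finset.range k, D.u R₁ R₂ n i := by
  classical
  have hsub : {ω : List Bool | ¬ (D.CoinGood n ((D.Bnd R₁ R₂).eval n) (D.sOf R₁ R₂ n ω) ∧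
      D.CoinGood n ((D.S.ℓ₁ R₁).eval n) (D.rOf R₁ R₂ n ω) ∧ D.RC R₁ R₂ n (D.rOf R₁ R₂ n ω) k)} ⊆
      ({ω | ¬ D.CoinGood n ((D.Bnd R₁ R₂).eval n) (D.sOf R₁ R₂ n ω)} ∪
        {ω | D.rOf R₁ R₂ n ω ∈ {r : List Bool | ¬ D.CoinGood n ((D.S.ℓ₁ R₁).eval n) r}}) ∪
      ⋃ i ∈ Finset.range k, {ω | D.rOf R₁ R₂ n ω ∈ D.Wr R₁ R₂ n i} := by
    intro ω hω
    simp only [Set.mem_setOf_eq, not_and] at hω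
    by_cases hs : D.CoinGood n ((D.Bnd R₁ R₂).eval n) (D.sOf R₁ R₂ n ω)
    · by_cases hr : D.CoinGood n ((D.S.ℓ₁ R₁).eval n) (D.rOf R₁ R₂ n ω)
      · have hRC : ¬ D.RC R₁ R₂ n (D.rOf R₁ R₂ n ω) k := hω hs hr
        simp only [RC, not_forall, exists_prop] at hRC
        obtain ⟨i, hi, hne⟩ := hRC
        refine Or.inr ?_
        simp only [Set.mem_iUnion, Finset.mem_range, exists_prop]
        exact ⟨i, hi, hr, hne⟩
      · exact Or.inl (Or.inr hr)
    · exact Or.inl (Or.inl hs)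
  refine (uniformProb_mono_set hsub).trans ?_
  refine (uniformProb_union_le _ _ _).trans (add_le_add ((uniformProb_union_le _ _ _).trans (add_le_add ?_ ?_)) ?_)
  · exact D.uniformProb_sOf_bad_le R₁ R₂ hS hn (le_of_add_le_left hM)
  · exact (D.uniformProb_rOf_mem_le R₁ R₂ hM _).trans (D.uniformProb_not_coinGood_le hS hn (by simp [βr]))
  · refine (uniformProb_biUnion_le M _ _).trans (Finset.sum_le_sum fun i _ => ?_)
    exact D.uniformProb_rOf_mem_le R₁ R₂ hM _

/-- `Σ_{i<k} u(n,i) ≤ 1/n²` when `k ≤ n` and each `u(n,i) < n⁻³`. [folklore] -/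
theorem sum_u_le {n k : ℕ} (hn : 1 ≤ n) (hk : k ≤ n) (h : ∀ i, i < k → D.u R₁ R₂ n i < 1 / (n : ℝ) ^ 3) :
    ∑ i ∈ Finset.range k, D.u R₁ R₂ n i ≤ 1 / (n : ℝ) ^ 2 := by
  calc ∑ i ∈ Finset.range k, D.u R₁ R₂ n i ≤ ∑ _i ∈ Finset.range k, 1 / (n : ℝ) ^ 3 :=
        Finset.sum_le_sum fun i hi => (h i (Finset.mem_range.1 hi)).le
    _ = k * (1 / (n : ℝ) ^ 3) := by rw [Finset.sum_const, Finset.card_range, nsmul_eq_mul]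
    _ ≤ n * (1 / (n : ℝ) ^ 3) := by gcongr
    _ = 1 / (n : ℝ) ^ 2 := by rw [mul_one_div, div_eq_div_iff (by positivity) (by positivity)]; ring

/-! ### The harvesting step and the endgame -/

/-- **Harvest.** At a stage `n ≥ 2` and depth `k < n` where all shallower depths are answered rightly
on all but `n⁻³` of the seeds but depth `k` is answered WRONGLY on at least `n⁻³` of them, the
candidate `M_b` with `b` the wrong answer prints, at length `P(n) + k`, a counterexample with
probability `≥ 2/3` (given enough coins and the numeric smallness of the error terms).
[cite: ChenEtAl2022, §5.2 (proof of Thm. 5: "the query made to A … is a counterexample")] -/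
theorem harvest (hS : D.Spec) {n k : ℕ} (hn : 2 ≤ n) (hk : k < n)
    (hIH : ∀ i, i < k → D.u R₁ R₂ n i < 1 / (n : ℝ) ^ 3) (huk : 1 / (n : ℝ) ^ 3 ≤ D.u R₁ R₂ n k)
    (hnum : (4 + 2 * (n : ℝ) ^ 4) * (1 / 2) ^ n + 1 / (n : ℝ) ^ 2 + 1 / ((n : ℝ) + 1) ≤ 1 / 3) {M : ℕ}
    (hM : (D.βs R₁ R₂).eval n + (D.βr R₁).eval n + n ^ 4 * (D.βr R₁).eval n ≤ M) :
    2 / 3 ≤ uniformProb M {ω | D.outM R₁ R₂ (!D.Bst R₁ n (D.zst R₁ n k ++ [false])) ((D.P R₁ R₂).eval n + k) ω ∈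
      D.Err ((D.P R₁ R₂).eval n + k)} := by
  classical
  set b := !D.Bst R₁ n (D.zst R₁ n k ++ [false]) with hbdef
  set w := D.zst R₁ n k ++ [false] with hw
  set m := (D.P R₁ R₂).eval n + k with hm
  have hb : (b = true ↔ ¬ D.T R₁ n w) := by
    rw [hbdef, ← Bst_eq_true_iff]; cases D.Bst R₁ n (D.zst R₁ n k ++ [false]) <;> simp
  set Hb : Set (List Bool) := {r | (D.inst R₁ R₂ n r w m ∈ D.L'' ↔ b = true)} with hHb
  -- the good event
  set G : Set (List Bool) := {ω | (D.CoinGood n ((D.Bnd R₁ R₂).eval n) (D.sOf R₁ R₂ n ω) ∧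
      D.CoinGood n ((D.S.ℓ₁ R₁).eval n) (D.rOf R₁ R₂ n ω) ∧ D.RC R₁ R₂ n (D.rOf R₁ R₂ n ω) k) ∧
    (∀ i, i < n ^ 4 → D.CoinGood n ((D.S.ℓ₁ R₁).eval n) (D.smp R₁ R₂ n ω i)) ∧
    (∃ i, i < n ^ 4 ∧ D.smp R₁ R₂ n ω i ∈ Hb)} with hG
  have hGsub : G ⊆ {ω | D.outM R₁ R₂ b m ω ∈ D.Err m} := by
    rintro ω ⟨⟨hs, -, hRC⟩, hsmp, hex⟩
    obtain ⟨hl, herr⟩ := D.outM_err R₁ R₂ hS hk hs hRC hsmp hb hex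
    exact ⟨hl, herr⟩
  -- its complement
  have hGc : Gᶜ ⊆ ({ω | ¬ (D.CoinGood n ((D.Bnd R₁ R₂).eval n) (D.sOf R₁ R₂ n ω) ∧
      D.CoinGood n ((D.S.ℓ₁ R₁).eval n) (D.rOf R₁ R₂ n ω) ∧ D.RC R₁ R₂ n (D.rOf R₁ R₂ n ω) k)} ∪
      {ω | ∃ i, i < n ^ 4 ∧ ¬ D.CoinGood n ((D.S.ℓ₁ R₁).eval n) (D.smp R₁ R₂ n ω i)}) ∪
      {ω | ∀ i, i < n ^ 4 → D.smp R₁ R₂ n ω i ∉ Hb} := by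
    intro ω hω
    rw [Set.mem_compl_iff] at hω
    by_cases h1 : D.CoinGood n ((D.Bnd R₁ R₂).eval n) (D.sOf R₁ R₂ n ω) ∧
        D.CoinGood n ((D.S.ℓ₁ R₁).eval n) (D.rOf R₁ R₂ n ω) ∧ D.RC R₁ R₂ n (D.rOf R₁ R₂ n ω) k
    · by_cases h2 : ∀ i, i < n ^ 4 → D.CoinGood n ((D.S.ℓ₁ R₁).eval n) (D.smp R₁ R₂ n ω i)
      · refine Or.inr fun i hi hmem => hω ?_
        exact ⟨h1, h2, i, hi, hmem⟩
      · refine Or.inl (Or.inr ?_)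
        show ∃ i, i < n ^ 4 ∧ ¬ D.CoinGood n ((D.S.ℓ₁ R₁).eval n) (D.smp R₁ R₂ n ω i)
        by_contra h3
        exact h2 fun i hi => by_contra fun hg => h3 ⟨i, hi, hg⟩
    · exact Or.inl (Or.inl h1)
  -- the three error terms
  have hn1 : (1 : ℝ) ≤ n := by exact_mod_cast (show 1 ≤ n by omega)
  have hnpos : (0 : ℝ) < n := by linarith
  have e1 : uniformProb M {ω | ¬ (D.CoinGood n ((D.Bnd R₁ R₂).eval n) (D.sOf R₁ R₂ n ω) ∧
      D.CoinGood n ((D.S.ℓ₁ R₁).eval n) (D.rOf R₁ R₂ n ω) ∧ D.RC R₁ R₂ n (D.rOf R₁ R₂ n ω) k)} ≤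
      4 * (1 / 2) ^ n + 1 / (n : ℝ) ^ 2 := by
    have h := D.uniformProb_not_walkGood_le R₁ R₂ hS hn (k := k) (M := M) (by omega)
    have hs := D.sum_u_le R₁ R₂ (show 1 ≤ n by omega) hk.le hIH
    linarith
  have e2 : uniformProb M {ω | ∃ i, i < n ^ 4 ∧ ¬ D.CoinGood n ((D.S.ℓ₁ R₁).eval n) (D.smp R₁ R₂ n ω i)} ≤
      (n : ℝ) ^ 4 * (2 * (1 / 2) ^ n) := by
    have := D.uniformProb_smp_bad_le R₁ R₂ hS hn hM
    exact_mod_cast this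
  have e3 : uniformProb M {ω | ∀ i, i < n ^ 4 → D.smp R₁ R₂ n ω i ∉ Hb} ≤ 1 / ((n : ℝ) + 1) := by
    refine (D.uniformProb_smp_allMiss_le R₁ R₂ hM Hb).trans ?_
    have hv0 : 0 ≤ uniformProb ((D.βr R₁).eval n) Hb := uniformProb_nonneg _ _
    have hv1 : uniformProb ((D.βr R₁).eval n) Hb ≤ 1 := uniformProb_le_one _ _
    refine (one_sub_pow_le hv0 hv1 _).trans ?_
    -- `v ≥ u(n,k) ≥ n⁻³`
    have hWr : D.Wr R₁ R₂ n k ⊆ Hb := by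
      rintro r ⟨-, hne⟩
      simp only [hHb, Set.mem_setOf_eq, hb]
      tauto
    have hv : 1 / (n : ℝ) ^ 3 ≤ uniformProb ((D.βr R₁).eval n) Hb := huk.trans (uniformProb_mono_set hWr)
    have hNv : (n : ℝ) ≤ (n ^ 4 : ℕ) * uniformProb ((D.βr R₁).eval n) Hb := by
      have h4 : ((n ^ 4 : ℕ) : ℝ) * (1 / (n : ℝ) ^ 3) = n := by
        push_cast; rw [mul_one_div, div_eq_iff (by positivity)]; ring
      calc (n : ℝ) = ((n ^ 4 : ℕ) : ℝ) * (1 / (n : ℝ) ^ 3) := h4.symm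
        _ ≤ _ := mul_le_mul_of_nonneg_left hv (by positivity)
    exact one_div_le_one_div_of_le (by linarith) (by linarith)
  -- assemble
  have hcompl : uniformProb M Gᶜ ≤ 1 / 3 := by
    refine (uniformProb_mono_set hGc).trans ?_
    refine (uniformProb_union_le _ _ _).trans ?_
    have h12 := (uniformProb_union_le M _ _).trans (add_le_add e1 e2)
    have hsum : 4 * (1 / 2 : ℝ) ^ n + 1 / (n : ℝ) ^ 2 + (n : ℝ) ^ 4 * (2 * (1 / 2) ^ n) + 1 / ((n : ℝ) + 1) ≤ 1 / 3 := by
      nlinarith [hnum]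
    linarith [h12, e3]
  have hG1 : uniformProb M G = 1 - uniformProb M Gᶜ := by rw [uniformProb_compl]; ring
  calc (2 : ℝ) / 3 ≤ uniformProb M G := by rw [hG1]; linarith
    _ ≤ _ := uniformProb_mono_set hGsub

/-- **Endgame, `T_y`.** If all depths `< n` are answered rightly on all but `n⁻³` of the seeds and the
canonical bad string `y*` is a counterexample, the candidate `T_y` prints a counterexample at length
`n` with probability `≥ 2/3`. [cite: ChenEtAl2022, §5.2 (proof of Thm. 5, the string p_n(x*))] -/
theorem endgameY (hS : D.Spec) {n : ℕ} (hn : 2 ≤ n) (hIH : ∀ i, i < n → D.u R₁ R₂ n i < 1 / (n : ℝ) ^ 3)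
    (hnum : 4 * (1 / 2 : ℝ) ^ n + 1 / (n : ℝ) ^ 2 ≤ 1 / 3) {M : ℕ} (hM : (D.βs R₁ R₂).eval n + (D.βr R₁).eval n ≤ M)
    (hy : D.yst R₁ n ∈ D.Err n) : 2 / 3 ≤ uniformProb M {ω | D.outY R₁ R₂ n ω ∈ D.Err n} := by
  set G : Set (List Bool) := {ω | D.CoinGood n ((D.Bnd R₁ R₂).eval n) (D.sOf R₁ R₂ n ω) ∧
      D.CoinGood n ((D.S.ℓ₁ R₁).eval n) (D.rOf R₁ R₂ n ω) ∧ D.RC R₁ R₂ n (D.rOf R₁ R₂ n ω) n} with hG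
  have hGsub : G ⊆ {ω | D.outY R₁ R₂ n ω ∈ D.Err n} := by
    rintro ω ⟨hs, -, hRC⟩
    show D.outY R₁ R₂ n ω ∈ D.Err n
    rwa [D.outY_eq R₁ R₂ hS hs hRC]
  have hGc : uniformProb M Gᶜ ≤ 1 / 3 := by
    have h := D.uniformProb_not_walkGood_le R₁ R₂ hS hn (k := n) hM
    have hs := D.sum_u_le R₁ R₂ (show 1 ≤ n by omega) le_rfl hIH
    have : Gᶜ = {ω | ¬ (D.CoinGood n ((D.Bnd R₁ R₂).eval n) (D.sOf R₁ R₂ n ω) ∧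
        D.CoinGood n ((D.S.ℓ₁ R₁).eval n) (D.rOf R₁ R₂ n ω) ∧ D.RC R₁ R₂ n (D.rOf R₁ R₂ n ω) n)} := rfl
    rw [this]
    linarith
  have hG1 : uniformProb M G = 1 - uniformProb M Gᶜ := by rw [uniformProb_compl]; ring
  calc (2 : ℝ) / 3 ≤ uniformProb M G := by rw [hG1]; linarith
    _ ≤ _ := uniformProb_mono_set hGsub

/-- **Endgame, `T_j`.** The same for the candidate printing the `j`-th level-1 probe instance at `y*`,
at length `ℓ₁(n)`. [cite: ChenEtAl2022, §5.2 (proof of Thm. 5, the queries of R^A(y, 1^m, 1^n) etc.)] -/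
theorem endgameJ (hS : D.Spec) {n : ℕ} (hn : 2 ≤ n) (hIH : ∀ i, i < n → D.u R₁ R₂ n i < 1 / (n : ℝ) ^ 3)
    (hnum : 4 * (1 / 2 : ℝ) ^ n + 1 / (n : ℝ) ^ 2 ≤ 1 / 3) {M : ℕ} (hM : (D.βs R₁ R₂).eval n + (D.βr R₁).eval n ≤ M)
    (j : ℕ) (hy : D.probeInst R₁ D.aT (D.yst R₁ n) j ∈ D.Err ((D.S.ℓ₁ R₁).eval n)) :
    2 / 3 ≤ uniformProb M {ω | D.outJ R₁ R₂ j ((D.S.ℓ₁ R₁).eval n) ω ∈ D.Err ((D.S.ℓ₁ R₁).eval n)} := by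
  set G : Set (List Bool) := {ω | D.CoinGood n ((D.Bnd R₁ R₂).eval n) (D.sOf R₁ R₂ n ω) ∧
      D.CoinGood n ((D.S.ℓ₁ R₁).eval n) (D.rOf R₁ R₂ n ω) ∧ D.RC R₁ R₂ n (D.rOf R₁ R₂ n ω) n} with hG
  have hGsub : G ⊆ {ω | D.outJ R₁ R₂ j ((D.S.ℓ₁ R₁).eval n) ω ∈ D.Err ((D.S.ℓ₁ R₁).eval n)} := by
    rintro ω ⟨hs, -, hRC⟩
    show D.outJ R₁ R₂ j ((D.S.ℓ₁ R₁).eval n) ω ∈ D.Err ((D.S.ℓ₁ R₁).eval n)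
    rwa [D.outJ_eq R₁ R₂ hS hs hRC j]
  have hGc : uniformProb M Gᶜ ≤ 1 / 3 := by
    have h := D.uniformProb_not_walkGood_le R₁ R₂ hS hn (k := n) hM
    have hs := D.sum_u_le R₁ R₂ (show 1 ≤ n by omega) le_rfl hIH
    have : Gᶜ = {ω | ¬ (D.CoinGood n ((D.Bnd R₁ R₂).eval n) (D.sOf R₁ R₂ n ω) ∧
        D.CoinGood n ((D.S.ℓ₁ R₁).eval n) (D.rOf R₁ R₂ n ω) ∧ D.RC R₁ R₂ n (D.rOf R₁ R₂ n ω) n)} := rfl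
    rw [this]
    linarith
  have hG1 : uniformProb M G = 1 - uniformProb M Gᶜ := by rw [uniformProb_compl]; ring
  calc (2 : ℝ) / 3 ≤ uniformProb M G := by rw [hG1]; linarith
    _ ≤ _ := uniformProb_mono_set hGsub

end Data

/-! ### Numeric smallness of the error terms -/

/-- Eventually `(4 + 2n⁴)·2⁻ⁿ + n⁻² + (n+1)⁻¹ ≤ 1/3`. [folklore] -/
theorem eventually_errorTerms_le :
    ∀ᶠ n : ℕ in atTop, (4 + 2 * (n : ℝ) ^ 4) * (1 / 2) ^ n + 1 / (n : ℝ) ^ 2 + 1 / ((n : ℝ) + 1) ≤ 1 / 3 := by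
  have ht : Tendsto (fun n : ℕ => (n : ℝ) ^ 4 / 2 ^ n) atTop (nhds 0) :=
    tendsto_pow_const_div_const_pow_of_one_lt 4 one_lt_two
  have h1 : ∀ᶠ n : ℕ in atTop, (n : ℝ) ^ 4 / 2 ^ n < 1 / 54 := ht.eventually (gt_mem_nhds (by norm_num))
  filter_upwards [h1, Filter.eventually_ge_atTop 9] with n hn hn9
  have hn9' : (9 : ℝ) ≤ n := by exact_mod_cast hn9
  have hpow : (0 : ℝ) < 2 ^ n := by positivity
  have hhalf : (1 / 2 : ℝ) ^ n = 1 / 2 ^ n := by rw [one_div_pow]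
  -- first term
  have t1 : (4 + 2 * (n : ℝ) ^ 4) * (1 / 2) ^ n ≤ 1 / 9 := by
    rw [hhalf]
    have h6 : (4 + 2 * (n : ℝ) ^ 4) ≤ 6 * (n : ℝ) ^ 4 := by nlinarith [pow_le_pow_left₀ (by norm_num : (0:ℝ) ≤ 1) (by linarith : (1:ℝ) ≤ n) 4]
    have h7 : (n : ℝ) ^ 4 / 2 ^ n * 6 ≤ 1 / 9 := by linarith
    calc (4 + 2 * (n : ℝ) ^ 4) * (1 / 2 ^ n) ≤ 6 * (n : ℝ) ^ 4 * (1 / 2 ^ n) :=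
          mul_le_mul_of_nonneg_right h6 (by positivity)
      _ = (n : ℝ) ^ 4 / 2 ^ n * 6 := by ring
      _ ≤ 1 / 9 := h7
  have t2 : 1 / (n : ℝ) ^ 2 ≤ 1 / 9 := by
    rw [div_le_div_iff₀ (by positivity) (by norm_num), one_mul]
    nlinarith
  have t3 : 1 / ((n : ℝ) + 1) ≤ 1 / 9 := by
    rw [div_le_div_iff₀ (by positivity) (by norm_num), one_mul]
    linarith
  linarith


end BPPNPRefuter

/-! ### Theorem 1.2, `(𝒞, 𝒟) = (BPP, NP)` -/

open BPPNPRefuter BPPNPRefuter.Data in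
/-- **Discharge of `constructiveSeparation_of_not_subset_BPP_NP`** (Chen–Jin–Santhanam–Williams,
Thm. 1.2 with `(𝒞, 𝒟) = (BPP, NP)`): if `NP ⊄ BPP` then every length-paddable `NP`-complete `L` is
`BPP`-constructively separated from `BPP` — against every `L'' ∈ BPP` some probabilistic
polynomial-time machine prints, on `1ᵐ`, an `m`-bit string of `L ∆ L''` with probability `≥ 2/3` for
infinitely many `m`. Proof: the module docstring (two-level search with the amplified algorithm's seed
in the instance, §5.2/§5.1; every depth at its own length; contradiction over the eight candidates).
[cite: ChenEtAl2022, Thm. 1.2 and §5.2 (Thm. 5, Cor. 4) with §5.1 (Lemma 6, proof of Thm. 4)] -/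
theorem constructiveSeparation_of_not_subset_BPP_NP_holds : constructiveSeparation_of_not_subset_BPP_NP := by
  intro hNP L hL hpad L'' hL''
  classical
  by_contra hnone
  push Not at hnone
  -- the data
  obtain ⟨V, hVP, p, hV⟩ := mem_NP_iff_verifier.1 hL.mem
  obtain ⟨pad, hpadC, hpadS⟩ := hpad
  obtain ⟨Lamp, hLampP, q, hq⟩ := BPP_subset_bpErr_two_pow 2 hL''
  set D : Data := ⟨L, pad, fun x => V.boolIndicator x, p, L'', Lamp, q⟩ with hDdef
  have hS : D.Spec :=
    { spec :=
        { pad_length := fun x m h => (hpadS x m h).1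
          pad_mem := fun x m h => (hpadS x m h).2
          ver := fun x => (hV x).trans <| by
            simp only [hDdef]
            exact exists_congr fun w => and_congr Iff.rfl (Set.mem_iff_boolIndicator _ _) }
      amp := fun x => hq x }
  have hC : D.Codes := ⟨codeFP_pad hpadC, of_fn _ (indicatorFn_mem_FP hVP) fun _ => rfl, hLampP⟩
  obtain ⟨R₁⟩ := Red.nonempty_of_karpReducible (hL.isHard _ (D.S.H₁_mem_NP hC.S.Vb))
  obtain ⟨R₂⟩ := Red.nonempty_of_karpReducible (hL.isHard _ (D.H₂_mem_NP R₁ hS hC))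
  set c := D.coinPoly R₁ R₂ with hc
  -- none of the eight candidates is a refuter
  have hM : ∀ b : Bool, ∀ᶠ n in atTop, ∀ m, n ≤ m →
      uniformProb (c.eval m) {ω | D.outM R₁ R₂ b m ω ∈ D.Err m} < 2 / 3 := fun b => by
    obtain ⟨f, hf, hfF⟩ := codeFP_outM (D := D) (R₁ := R₁) (R₂ := R₂) hC b
    exact eventually_lt_of_not_refuter (F := fun m ω => D.outM R₁ R₂ b m ω) hf (fun m ω => hfF (m, ω)) c (hnone _)
  have hY : ∀ᶠ n in atTop, ∀ m, n ≤ m → uniformProb (c.eval m) {ω | D.outY R₁ R₂ m ω ∈ D.Err m} < 2 / 3 := by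
    obtain ⟨f, hf, hfF⟩ := codeFP_outY (D := D) (R₁ := R₁) (R₂ := R₂) hC
    exact eventually_lt_of_not_refuter (F := fun m ω => D.outY R₁ R₂ m ω) hf (fun m ω => hfF (m, ω)) c (hnone _)
  have hJ : ∀ j : ℕ, ∀ᶠ n in atTop, ∀ m, n ≤ m →
      uniformProb (c.eval m) {ω | D.outJ R₁ R₂ j m ω ∈ D.Err m} < 2 / 3 := fun j => by
    obtain ⟨f, hf, hfF⟩ := codeFP_outJ (D := D) (R₁ := R₁) (R₂ := R₂) hC j
    exact eventually_lt_of_not_refuter (F := fun m ω => D.outJ R₁ R₂ j m ω) hf (fun m ω => hfF (m, ω)) c (hnone _)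
  have hJ5 : ∀ᶠ n in atTop, ∀ j, j < 5 → ∀ m, n ≤ m →
      uniformProb (c.eval m) {ω | D.outJ R₁ R₂ j m ω ∈ D.Err m} < 2 / 3 := by
    have h : ∀ᶠ n in atTop, ∀ j ∈ Finset.range 5, ∀ m, n ≤ m →
        uniformProb (c.eval m) {ω | D.outJ R₁ R₂ j m ω ∈ D.Err m} < 2 / 3 :=
      (Finset.eventually_all (Finset.range 5)).2 fun j _ => hJ j
    exact h.mono fun n hn j hj => hn j (Finset.mem_range.2 hj)
  -- a large bad stage
  have hfreq : ∃ᶠ n in atTop, ∃ x : List Bool, x.length = n ∧ (x ∈ L ↔ x ∉ L'') :=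
    frequently_exists_errs_of_isComplete_NP hNP hL hL''
  obtain ⟨n, hbad, hn2, hMt, hMf, hYn, hJn, hnum⟩ :=
    (hfreq.and_eventually ((Filter.eventually_ge_atTop 2).and ((hM true).and ((hM false).and
      (hY.and (hJ5.and eventually_errorTerms_le)))))).exists
  have hnum' : 4 * (1 / 2 : ℝ) ^ n + 1 / (n : ℝ) ^ 2 ≤ 1 / 3 := by
    have h1 : (0 : ℝ) ≤ 2 * (n : ℝ) ^ 4 * (1 / 2) ^ n := by positivity
    have h2 : (0 : ℝ) ≤ 1 / ((n : ℝ) + 1) := by positivity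
    nlinarith [hnum]
  -- every depth is answered rightly on all but `n⁻³` of the seeds
  have hu : ∀ k, k < n → D.u R₁ R₂ n k < 1 / (n : ℝ) ^ 3 := by
    intro k
    induction k using Nat.strong_induction_on with
    | _ k ih =>
      intro hk
      by_contra hge
      rw [not_lt] at hge
      have hcoins := D.blocks_le_coinPoly R₁ R₂ (show n ≤ (D.P R₁ R₂).eval n + k from (D.le_P R₁ R₂ n).trans (Nat.le_add_right _ _))
      have h := D.harvest R₁ R₂ hS hn2 hk (fun i hi => ih i hi (hi.trans hk)) hge hnum hcoins
      cases hB : D.Bst R₁ n (D.zst R₁ n k ++ [false])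
      · rw [hB] at h
        have h' := hMt ((D.P R₁ R₂).eval n + k) ((D.le_P R₁ R₂ n).trans (Nat.le_add_right _ _))
        simp only [Bool.not_false] at h
        linarith
      · rw [hB] at h
        have h' := hMf ((D.P R₁ R₂).eval n + k) ((D.le_P R₁ R₂ n).trans (Nat.le_add_right _ _))
        simp only [Bool.not_true] at h
        linarith
  have hcoins0 : (D.βs R₁ R₂).eval n + (D.βr R₁).eval n ≤ c.eval n :=
    le_of_add_le_left (D.blocks_le_coinPoly R₁ R₂ le_rfl)
  have hcoins1 : (D.βs R₁ R₂).eval n + (D.βr R₁).eval n ≤ c.eval ((D.S.ℓ₁ R₁).eval n) :=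
    le_of_add_le_left (D.blocks_le_coinPoly R₁ R₂ (D.le_ℓ₁ R₁ n))
  -- `L''` is right on `y*` …
  have hy : D.yst R₁ n ∉ D.Err n := fun hy => by
    have h := D.endgameY R₁ R₂ hS hn2 hu hnum' hcoins0 hy
    have h' := hYn n le_rfl
    linarith
  have hycorr : (D.yst R₁ n ∈ D.L'' ↔ D.yst R₁ n ∈ D.L) := by
    simp only [mem_Err, length_yst, true_and] at hy
    tauto
  -- … and on the five level-1 probe instances at `y*`
  have hpr : ∀ j, j < 5 → (D.probeInst R₁ D.aT (D.yst R₁ n) j ∈ D.L'' ↔ D.probeInst R₁ D.aT (D.yst R₁ n) j ∈ D.L) := by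
    intro j hj
    have hnot : D.probeInst R₁ D.aT (D.yst R₁ n) j ∉ D.Err ((D.S.ℓ₁ R₁).eval n) := fun hyj => by
      have h := D.endgameJ R₁ R₂ hS hn2 hu hnum' hcoins1 j hyj
      have h' := hJn j hj ((D.S.ℓ₁ R₁).eval n) (D.le_ℓ₁ R₁ n)
      linarith
    have hlen : (D.probeInst R₁ D.aT (D.yst R₁ n) j).length = (D.S.ℓ₁ R₁).eval n := by
      rw [D.length_probeInst R₁ hS, length_yst]
    simp only [mem_Err, hlen, true_and] at hnot
    tauto
  exact D.false_of_correct R₁ hS (D.bad₂_yst R₁ hS hbad) hycorr hpr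


end Literature.Computability.MetaComplexity

end
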